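import Summits.AtomisticToContinuum.FouriersLaw.Theses.EmbeddedDrudeMourre

/-!
# Disproof of `FGRGap` — standing-adversary work file (cdisprove; gen 2 cycle 1 + gen 3 cycle 2)

Crux (item `stmt-AtomisticToContinuum-12595`, decl `EmbeddedDrudeMourre.FGRGap`, rank 3):

  `∀ ω₂ a b : ℝ, 0 < ω₂ → 0 < a → 0 < b → PhononBoltzmann.HasOddSectorGap ω₂ a b`,

`HasOddSectorGap ω₂ a b := ∃ g > 0, ∀ f (2π-periodic, measurable, odd, ‖f‖² < ∞),
ofReal g · ‖f‖² ≤ q_{ω₂,a,b}(f)`, `q` = ALS's linearised 2↔2 phonon-Boltzmann Dirichlet form of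
the pinned band `ω² = ω₂ + 2(1 - cos k)` with vertex `Φ = a + 16b ∏ sin(k_j/2)` (lower Lebesgue
integral over the `(k₁,k₃)`-chart, `finsum` over the resonant `k₂ ∈ (-π,π]`).

## VERDICT after cycle 2 (gen 3, 2026-08-16): STILL NO KILL — and the picked line survives too.
New this cycle (details §8–§11 at the end of the file; scripts `num/{band,foldgal,linalg,tail_law}.py`
attached as evidence; kit queue saturated again — 1584 queued, cdisprove jobs waiting > 3.5 h — so all
numerics are pure python on the hub, seconds each):
* the six registered stubs of line `log-coercive-compact-resolvent` were read symbol by symbol: none is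
  cheaply false, vacuous or junk-exploitable (§10); the hardest, STUB 2 `grazingDecorrelation`, is
  numerically TRUE fold-locally with MARGINAL constant `c* = 1.0 ± 0.15` and `C ≈ 11–20` (direct Rayleigh
  minimisation of `Q_H − μG` over nested 60-dimensional multiscale spaces at the fold, four parameter
  points; §9c) — the planner's small ratios `Q_H/G = 0.065/0.013/0.0029` are pre-asymptotic and are what
  `C` pays for;
* PROVED here (§8, sorry-free; LANDED as `Theorems/FGRGap/Negative/LogCoerciveLine.lean`, p80831): the
  additive constant `C` of `LogCoerciveAt` and of STUB 2 is LOAD-BEARING — `q(ω) = Q_H(ω) = 0 < G(ω)` for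
  the energy invariant `ω`, for every `ω₂ > 0`, every vertex and every a.e.-resonant partner map `H`;
* STRUCTURE the provers should use (§9b, new): the moving partner map is, to first order, a CONJUGATE of
  the velocity involution, `T_t = τ_{-t/2} ∘ * ∘ τ_{t/2} + O(t²)` (`|H(k,t) − (k+t/2)* − t/2| ≤ 0.12 t²`), so
  the bracket is `g̃_t∘* − g̃_t` on SYMMETRIC differences `g̃_t = f(·+t/2) − f(·−t/2)` and decorrelation is
  a second-order (`≍ κt²`: curvature of `*` + drift `β₂t²`) effect — which is exactly why the marginal
  constant is `1` (half of every octave decorrelates, with twice the integrand);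
* the `δ^{5.5}` tail of the gap constant (cycle 1 §3(A), §7) is DERIVED (§9d): weight `≍ ω₂^{-7/2}` times
  bracket² `≍ ω₂^{-2}` on the soft odd `π`-periodic sector, and the order-`1/ω₂` perturbation of the
  degenerate `P = π` resonance admits NO odd invariant (measured slopes `−3.44 → −7/2` for `sin k`,
  `−5.40 → −11/2` for `sin 2k` at `ω₂ = 80–160`);
* the chord construction of card chord-quartic-abel, implemented in closed form, returns the unique
  non-trivial partner for 20000/20000 random pairs (momentum residual `≤ 1e-14`): uniqueness of the
  non-trivial root — the `IsGrazingBranch` clause of STUBS 1–2 — holds for EVERY `t₀`, not only small;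
* literature (cycle 1 was search-degraded): Spohn 2006's classification is `d ≥ 2` only (read);
  Mendl–Lu–Lukkarinen 2016 §3 still state the 1-d nearest-neighbour pinned classification as an
  expectation; nothing negative in print (§11).

## VERDICT (cycle 1 of gen 2): NO KILL — the crux resists every cheap and every structural attack
tried so far and is very probably TRUE. No refutation is filed. Findings, all numbers reproducible
with the pure-python scripts attached as evidence (`num/*.py`, no numpy; kit queue saturated —
3160 queued jobs, p50 wait 688 s, gen-1's j005121/j005122 never reported — so everything below ran
on the hub in minutes):

## (0) Typed-statement audit (independent re-read; agrees with rattack / rreview / gen 1)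
* `boltzmannForm` is a LOWER Lebesgue integral: `+∞` off the form domain, never Bochner-junk `0`;
  `x/0 = 0` only in the Jacobian on a null set; `finsum` over an infinite set (= `0`) happens
  exactly on the diagonal `k₁ - k₃ ∈ 2πℤ`, where the bracket of a periodic `f` vanishes anyway.
  Proved here (§4): `resonantSet_finite` — OFF the diagonal the resonant set IS finite
  (`k₂ ↦ Ω` real-analytic for `ω₂ > 0`, not identically zero unless `k₁ - k₃ ∈ 2πℤ`; identity
  theorem + compactness; stated for arbitrary real `k₁, k₃` with `k₁ - k₃ ∉ 2πℤ` — the cell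
  version landed independently the same evening as `PhononBoltzmann.resonantSet_finite`,
  `Literature/…/PinnedChainResonantFinite.lean`, which the gate proposal p70445 of §5–6 reuses).
  Hence no `finsum` junk anywhere off a null set, and the form is monotone in the kernel
  (`boltzmannForm_mono_weight`, §5; §5–6 proposed sorry-free as
  `Theorems/FGRGap/Negative/OnsiteReduction.lean`, p70445).
* Quantifier order `∃ g ∀ f` per `(ω₂,a,b)`: `g` may depend on all three parameters (no uniformity
  asked — and none holds, §7).
* No hidden triviality: `q(sin) < ∞` (`q(sin)/π = 0.0659` at `(ω₂,a,b) = (1,1,0)`, `0.1195` at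
  `(1,1,1)`), so `g ≤ q(sin)/‖sin‖²`; not vacuous.

## (1) Load-bearing hypotheses (each PROVED necessary in §2, witnesses in Lean)
| dropped hypothesis | false because | theorem |
|---|---|---|
| `f` periodic | crystal momentum `k ↦ k` is an exact null vector (bracket ≡ 0) | `hasOddSectorGapWithoutPeriodic_false` |
| `f` odd | phonon number `1` (and energy `ω`) are null vectors | `hasOddSectorGapWithoutOdd_false` |
| `0 < ω₂` (as typed) | `ω₂ ≤ -4`: band, kernel, form are the junk `0` | `cruxWithoutOmegaPos_false` |
| `0 < a ∧ 0 < b` (both dropped) | harmonic chain `Φ ≡ 0`, `q ≡ 0` | `cruxWithoutCouplings_false` |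
| `0 < a` alone | `a = 0`: `Φ_{0,b} ∝ sin(k₁/2)` kills the grazing rate at `k = 0`; odd bumps of width `ε` at `0` have quotient `0.0559, 0.0164, 0.00414, 0.00102` for `ε = .4,.2,.1,.05` — slope `→ 2.0`, i.e. `q/‖f‖² ≍ ε² → 0` (`packets.py 1 0 1 zero-odd`) | `not_hasOddSectorGap_zero_onsite` (sorried near-miss, §7) |
| `0 < b` alone | NOT load-bearing: `b = 0` is ALS's model, Galerkin bottom `5.52e-3` at `ω₂ = 1`; indeed the crux IMPLIES the `b = 0` gap (§6) | `onsite_of_crux` |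

## (2) Normal forms / reductions a disproof may use (§3, §6; all sorry-free)
* `hasOddSectorGap_smul_iff`: `(a,b) ~ (εa,εb)`; `crux_iff_unit_onsite`: crux ⇔ `∀ ω₂>0 ∀ r>0,
  HasOddSectorGap ω₂ 1 r`.
* `onsite_of_crux`: crux ⇒ `∀ ω₂ > 0, HasOddSectorGap ω₂ 1 0` (ALS on-site gap is NECESSARY: the
  cleanest disproof target, `b` eliminated); `crux_on_cone_of_onsite`: that on-site family gives the
  crux back on the cone `0 ≤ 16b < a` (vertex comparison `a - 16b ≤ Φ ≤ a + 16b`). The complement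
  `a ≤ 16b` (where `Φ` may vanish on a curve of the resonant manifold iff `a ≤ 4b`, card
  grazing-jet-rigidity) is NOT reducible to `b = 0` by kernel comparison, but nothing else changes
  there: the grazing collisions have `∏ sin(k_j/2) = sin²(k/2) sin²(k*/2) ≥ 0`, so `Φ ≥ a` on them.
* `cellNormSq_eq_zero_of_crux`: crux ⇒ no odd `L²` collisional invariant of positive norm at any
  `ω₂ > 0` (kill criterion (b) of the route, contrapositive; `not_hasOddSectorGap_of_odd_invariant`).

## (3) Attacks run this cycle (numbers; `ω₂ = 1`, `(a,b) = (1,0)` unless stated; `k_m = 1.1789`)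
Pipeline validated: unique non-perturbative root per off-diagonal `(k₁,k₃)` (brute-force scan of
552 pairs, 3000 samples: 0 extra roots, residual `≤ 1.6e-15`); `q(ω) ≈ 1e-31`; umklapp fraction
`0.44`; Galerkin bottom (sin basis, `N = 16`, grids `96²/160²`) `λ_min/π = 5.5225e-3` at `(1,1,0)`,
`1.1230e-2` at `(1,1,1)` = rattack/gen-1 values to 4 digits.
* (A) ODD NULL VECTOR at special `ω₂`? `scan.py`: 25-point geometric scan `ω₂ ∈ [0.05, 20]` at
  `(1,0)` and `(1,1)`: `λ_min` STRICTLY DECREASING, no dip (`0.294 → 4.68e-8` resp.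
  `0.403 → 8.64e-8`); tail `∝ δ^{≈5.5}`, `δ = 1/(ω₂+2)`. Mechanism of the tail (not a refutation —
  `g` may depend on `ω₂`): as `δ → 0` the non-trivial resonances collapse onto total momentum
  `P = k₁ + k₂ = π`, on which EVERY odd `π`-periodic function (`sin 2nk`) is an exact invariant
  (`ψ(π/2+u) + ψ(π/2-u) = 0`); at `δ > 0` they are only `O(δ)`-almost invariant. By-product for
  `KineticConductivityFinite`: the current `sin k/ω²` overlaps this soft sector at relative order
  `δ`, whose inverse gap is `δ⁻²` larger ⇒ an `O(1)` contribution to `⟨φ, L⁻¹φ⟩` as `δ → 0` from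
  EVEN harmonics, consistent with rattack's `lim c(δ→0+) ≥ 0.2918 ≠ c(0) = 0.2756` (ALS06's
  `c(0)` inverts `L` on odd harmonics only).
* (B) NON-COMPACT MINIMISING SEQUENCES (coercivity half; new): every concentrating family has
  quotient `→ ∞`, with the rates predicted by the grazing geometry (`packets.py`):
  - regular point (`k₀ = 2.4`, and `k₀ = 0`): `q/‖f‖² = c₀ log(1/ε) + O(1)`, increments per
    halving `0.044, 0.044, 0.044` at `k₀ = 0` (`c₀ ≈ 0.063`), i.e. the LOG law of card
    log-coercive-compact-resolvent;
  - fold point `k_m` (partner `k* = k`), profile EVEN about `k_m`: slope `-1.19, -1.08, -1.05`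
    ⇒ `≍ ε⁻¹`;
  - fold point, profile ODD about `k_m` (card B's feared near-extremisers): slope
    `-0.64, -0.58, -0.55` (`ε = .4 … .025`) ⇒ `≍ ε^{-1/2}` → ∞; same law at `ω₂ = 0.3`
    (`-0.47, -0.59`) and `ω₂ = 4` (`-0.63, -0.53`); with `b`: `(1,1,1)` slopes `-0.98, -0.83`,
    `(1,0.25,1)` (`a < 4b`, vanishing-vertex curve present) `-0.74, -0.75`.
    WHY (fold normal form, derived in NOTES.md §fold): near `P = 2k_m + 2η` the band sum is
    `E_P(u) = E₀ - αη u² + βu⁴`, `α = -ω‴(k_m) > 0`, `β = ω⁗(k_m)/12`, so non-trivial resonances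
    are the circles `u² + u'² = αη/β`: the collision centre DRIFTS off `k_m` by
    `η = (β/α)(u² + u'²)` (= gen-1's partner drift `β₂t²`, `β₂ = 2β/α`), which destroys the
    odd-about-`k_m` cancellation once `u ≳ √ε`; the invariant measure is `2 du du'/(α|u²-u'²|)`
    (scale-free), whence `q ≍ √ε` against `‖f‖² ≍ ε`.
  - grazing-ADAPTED chirps `f_n' = cos(nπ ω'/ω'_max) - c_n` (first-order grazing condition
    `f'(k) = f'(k*)` built in; `chirps_scan.py`): quotient `0.0214, 0.0278, 0.0315, 0.0334, 0.0348`
    for `n = 2 … 32` — increasing, never below `4×` the Galerkin bottom; increments shrink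
    (`6.4e-3 → 1.3e-3`), so whether THIS sequence is log-unbounded is not settled at `n ≤ 32`
    (irrelevant for the crux, relevant only for compact-resolvent claims).
  - tuned two-window cancellation (`localgal.py`, the sharpest test of log-coercivity): Galerkin
    over odd-symmetrised Gaussian bumps filling windows of radius `r` around `k₀ = 2.4` AND its
    partner `k₀* = 0.3443` (the minimiser may correlate the two): local bottom
    `0.0173, 0.0420, 0.0713, 0.1034` for `r = .4, .2, .1, .05` (single window: `.076, .082, .100,
    .124`): correlation lowers the quotient (factor 4 at `r = 0.4`) but the growth per halving
    (`0.025, 0.029, 0.032`) persists ⇒ log-coercivity survives the adversarial test.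
* (C) THE `L²` LOOPHOLE (non-smooth invariants; new): gen 1 proved "no odd C¹ invariant" (all
  `ω₂ > 0`); an `L²` null vector must first be bootstrapped to `C¹` by averaging the a.e. identity
  `ψ(k₁) = ψ(k₃) + ψ(k₄) - ψ(h)` in `k₃`, which needs `∂₃h ≠ 0` and `∂₃k₄ = ∂₃h - 1 ≠ 0` on a
  window, for every `k₁`. `bootstrap_deg.py` (360² grid, `ω₂ ∈ {0.2, 1, 4, 20}`): `∂₃h` has EXACTLY
  2 transversal sign changes per `k₁`-row (measure of `{|∂₃h| < tol}` = `0.0027/0.013/0.065` for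
  `tol = .002/.01/.05` at `ω₂ = 0.2`: linear in tol ⇒ curves), and `∂₃h - 1` NEVER vanishes:
  range of `∂₃h` = `[-1.79, 0.64]`, `[-0.618, 0.382]`, `[-0.207, 0.172]`, `[-0.048, 0.046]`. So the
  `k₄`-averaging map is a submersion everywhere and the `h`-map off two curves: no obstruction to
  the LS08 §5 bootstrap at any tested `ω₂`; no room for a wild odd invariant.
* (D) Sawtooth / sign / near-invariants of the momentum type: killed by umklapp (fraction
  `0.44`; rattack `0.40–0.50` on `ω₂ ∈ [0.1, 198]`), nothing new.

## (4) Why it resists — the proof the numbers point to (for the provers)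
FGRGap ⇐ (i) compactness below some level [log-coercivity `q(f) + C‖f‖² ≥ c Σ log(2+|n|)|f̂ₙ|²`,
from the uniformly positive coefficient `W(k,k*)Φ²/|ω″(k*)| ≥ c·a² > 0` of the log-divergent
grazing rate — needs `0 < a`, and by (B) nothing softer than `log` exists] + (ii) `L²` null
vectors are `C^∞` [averaging bootstrap, unobstructed by (C)] + (iii) no odd `C¹` invariant
[gen 1, `NoOddC1Invariant.lean`, evidence on this item: parity family ⇒ `π`-periodicity, fold
family ⇒ `ψ′(p) = ψ′(p*)`, `ρ = (π-·)∘*` has no interior fixed point since `ω(π-k) = ω(k)` only at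
`π/2 ≠ k_m`]. (i) is the only analytic estimate left; (ii)–(iii) are classification.

## (5) What could still kill it (written end of cycle 1; cycle-2 status in brackets)
* a bounded-quotient weakly-null odd sequence (would not refute the crux by itself but would
  falsify route (i); candidates exhausted: chirps with second-order grazing adaptation)
  [cycle 2: direct minimisation over multiscale fold-local spaces finds none; marginal `c* ≈ 1`, §9c];
* an `ω₂` where the fold point degenerates (`ω⁗(k_m) = 0`, i.e. `β = 0`: drift `η ≍ u⁴`, fold
  packets then `≍ ε^{-1/4}`, still `→ ∞` — checked analytically, not a kill);
* the un-typed corner `a ≤ 4b` has no extra mechanism (vertex zero curve is transversal to the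
  grazing set) — only the constant degrades (`(1,0.25,1)`: fold quotient `0.10 → 0.29`).
* Literature: searchd unavailable throughout this session (rc 75 ×3) — no new negative result
  could be looked for [cycle 2: done, §11 — nothing negative in print; Spohn 2006 is `d ≥ 2`]; grounder/rattack/gen-1 record the classification as OPEN in print
  (ALS06 after (4.9); Lukkarinen2016 §3.4; LS08 Thm 2.2 is the FPU band).

## Landed / proposed (importable by ideators / planners / provers)
* cycle 2 (gen 3): `Theorems/FGRGap/Negative/LogCoerciveConstants.lean` — §8 of this file with the
  functionals unfolded (`not_logCoercive_without_C`, `no_grazingDecorrelation_without_C`,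
  `gagliardo_dispersion_pos`, `grazing_dispersion_eq_zero`, `measurable_dispersion`,
  `cellNormSq_dispersion_lt_top`, `dispersion_lt_dispersion`); p80831 ACCEPTED 2026-08-16T05:02Z, commit 50c2de0ce228 (namespace
  `Summit.AtomisticToContinuum.FouriersLaw.Theorems.FGRGap.Negative.LogCoerciveLine`; also the §8b STUB-1
  inputs `vertex_ge_on_strip`, `resonanceJacobian_le`, `prod_dispersion_sq_le`, `collisionWeight_ge_on_strip`).
## Landed through the gate in cycle 1 (gen 2)
* `Summits/AtomisticToContinuum/FouriersLaw/Theorems/FGRGap/Negative/OnsiteReduction.lean`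
  (p70445, commit 7529a64875b0): §5–6 — `boltzmannForm_mono_weight`, `hasOddSectorGap_of_weight_le`,
  vertex range, `onsite_of_crux`, `crux_on_cone_of_onsite`.
* `Summits/AtomisticToContinuum/FouriersLaw/Theorems/FGRGap/Negative/LoadBearing.lean`
  (p70551, commit 0cee979f356a): §0–3 — cell norms, kill switch, `…_false_without_…`, normal forms.
  (Namespaces `Summit.AtomisticToContinuum.FouriersLaw.Theorems.FGRGap.Negative.{OnsiteReduction,
  LoadBearing}`; this work file keeps its own copies under `…Cruxes.FGRGap.Disproof`.)

## Provenance
Gen-1's Disproof.lean / ANALYSIS.md / NoOddC1Invariant.lean (evidence on the item, 2026-08-15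
22:3x–22:55Z) are NOT readable from this seat's jail (run/gate not mounted; `ledger crux cat` had
no workfile): their cheap negatives are RE-DERIVED here (§1–2) and §3–7 are new. Census/handoff in
the seat's NOTES.md.
-/

noncomputable section

open MeasureTheory Set Real Filter Topology
open scoped ENNReal
open Literature.MathematicalPhysics.KineticTheory.PhononBoltzmann

namespace Summit.AtomisticToContinuum.FouriersLaw.Cruxes.FGRGap.Disproof

/-- The crux unfolds to the typed family of form inequalities. -/
theorem crux_iff : Summit.AtomisticToContinuum.FouriersLaw.Theses.EmbeddedDrudeMourre.FGRGap ↔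
    ∀ ω₂ a b : ℝ, 0 < ω₂ → 0 < a → 0 < b → HasOddSectorGap ω₂ a b := Iff.rfl

/-! ## 0. Basic measure-theoretic values on the Brillouin cell -/

/-- The Brillouin cell `(-π, π]` has Lebesgue measure `2π`. [folklore] -/
theorem volume_cell : volume (Ioc (-π) π) = ENNReal.ofReal (2 * π) := by
  rw [Real.volume_Ioc]; congr 1; ring

/-- `‖1‖² = 2π`. -/
theorem cellNormSq_one : cellNormSq (fun _ => (1 : ℝ)) = ENNReal.ofReal (2 * π) := by
  unfold cellNormSq
  rw [setLIntegral_const, volume_cell]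
  simp

/-- `0 < ‖k ↦ k‖²` (the non-periodic momentum function). -/
theorem cellNormSq_id_pos : 0 < cellNormSq (fun k => k) := by
  unfold cellNormSq
  have hsub : Ioc (π / 2) π ⊆ Ioc (-π) π := by
    intro k hk; exact ⟨by linarith [hk.1, Real.pi_pos], hk.2⟩
  have h1 : ∫⁻ k in Ioc (π / 2) π, ENNReal.ofReal ((π / 2) ^ 2) ≤
      ∫⁻ k in Ioc (π / 2) π, ENNReal.ofReal (k ^ 2) := by
    apply setLIntegral_mono' measurableSet_Ioc
    intro k hk
    apply ENNReal.ofReal_le_ofReal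
    have : 0 < π / 2 := by positivity
    nlinarith [hk.1]
  have h2 : ∫⁻ k in Ioc (π / 2) π, ENNReal.ofReal (k ^ 2) ≤
      ∫⁻ k in Ioc (-π) π, ENNReal.ofReal (k ^ 2) := lintegral_mono_set hsub
  rw [setLIntegral_const, Real.volume_Ioc] at h1
  have hpos : 0 < ENNReal.ofReal ((π / 2) ^ 2) * ENNReal.ofReal (π - π / 2) := by
    apply ENNReal.mul_pos
    · have : 0 < (π / 2) ^ 2 := by positivity
      exact fun h0 => absurd (ENNReal.ofReal_eq_zero.mp h0) (not_le.mpr this)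
    · have : 0 < π - π / 2 := by linarith [Real.pi_pos]
      exact fun h0 => absurd (ENNReal.ofReal_eq_zero.mp h0) (not_le.mpr this)
  exact lt_of_lt_of_le hpos (h1.trans h2)

/-- `‖k ↦ k‖² < ∞`. -/
theorem cellNormSq_id_lt_top : cellNormSq (fun k => k) < ∞ := by
  unfold cellNormSq
  have h1 : ∫⁻ k in Ioc (-π) π, ENNReal.ofReal (k ^ 2) ≤
      ∫⁻ _ in Ioc (-π) π, ENNReal.ofReal (π ^ 2) := by
    apply setLIntegral_mono measurable_const
    intro k hk
    apply ENNReal.ofReal_le_ofReal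
    nlinarith [hk.1, hk.2, Real.pi_pos]
  rw [setLIntegral_const] at h1
  exact lt_of_le_of_lt h1 (ENNReal.mul_lt_top ENNReal.ofReal_lt_top (by simp))

/-- `0 < ‖sin‖²` (Jordan's inequality on `(π/4, π/2]`). -/
theorem cellNormSq_sin_pos : 0 < cellNormSq Real.sin := by
  unfold cellNormSq
  have hsub : Ioc (π / 4) (π / 2) ⊆ Ioc (-π) π := by
    intro k hk; constructor <;> linarith [hk.1, hk.2, Real.pi_pos]
  have h1 : ∫⁻ k in Ioc (π / 4) (π / 2), ENNReal.ofReal (1 / 4) ≤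
      ∫⁻ k in Ioc (π / 4) (π / 2), ENNReal.ofReal (Real.sin k ^ 2) := by
    apply setLIntegral_mono' measurableSet_Ioc
    intro k hk
    apply ENNReal.ofReal_le_ofReal
    have hk0 : 0 ≤ k := by linarith [hk.1, Real.pi_pos]
    have hj := Real.mul_le_sin hk0 hk.2
    have hhalf : 1 / 2 ≤ 2 / π * k := by
      rw [div_mul_eq_mul_div, le_div_iff₀ Real.pi_pos]
      linarith [hk.1]
    nlinarith
  have h2 : ∫⁻ k in Ioc (π / 4) (π / 2), ENNReal.ofReal (Real.sin k ^ 2) ≤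
      ∫⁻ k in Ioc (-π) π, ENNReal.ofReal (Real.sin k ^ 2) := lintegral_mono_set hsub
  rw [setLIntegral_const, Real.volume_Ioc] at h1
  have hpos : 0 < ENNReal.ofReal (1 / 4) * ENNReal.ofReal (π / 2 - π / 4) := by
    apply ENNReal.mul_pos
    · simp
    · have : 0 < π / 2 - π / 4 := by linarith [Real.pi_pos]
      exact fun h0 => absurd (ENNReal.ofReal_eq_zero.mp h0) (not_le.mpr this)
  exact lt_of_lt_of_le hpos (h1.trans h2)

/-- `‖sin‖² < ∞`. -/
theorem cellNormSq_sin_lt_top : cellNormSq Real.sin < ∞ := by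
  unfold cellNormSq
  have h1 : ∫⁻ k in Ioc (-π) π, ENNReal.ofReal (Real.sin k ^ 2) ≤
      ∫⁻ _ in Ioc (-π) π, ENNReal.ofReal 1 := by
    apply setLIntegral_mono measurable_const
    intro k _
    apply ENNReal.ofReal_le_ofReal
    exact Real.sin_sq_le_one k
  rw [setLIntegral_const] at h1
  exact lt_of_le_of_lt h1 (ENNReal.mul_lt_top ENNReal.ofReal_lt_top (by simp))

/-! ## 1. The generic contradiction: a null vector of positive norm kills any gap constant -/

/-- If `q(f) = 0` while `0 < ‖f‖²`, no `g > 0` satisfies `g‖f‖² ≤ q(f)`. -/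
theorem no_gap_of_null {g : ℝ} (hg : 0 < g) {N q : ℝ≥0∞} (hN : 0 < N) (hq : q = 0)
    (h : ENNReal.ofReal g * N ≤ q) : False := by
  rw [hq] at h
  have h0 : ENNReal.ofReal g * N = 0 := le_antisymm h bot_le
  rcases mul_eq_zero.mp h0 with h1 | h1
  · exact (ENNReal.ofReal_pos.mpr hg).ne' h1
  · exact hN.ne' h1

/-- **Kill switch (kill criterion (b) of the route, formally).** An odd `2π`-periodic measurable
null vector of the form with `0 < ‖ψ‖² < ∞` refutes `HasOddSectorGap ω₂ a b`. -/
theorem not_hasOddSectorGap_of_odd_null {ω₂ a b : ℝ} {ψ : ℝ → ℝ}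
    (hper : Function.Periodic ψ (2 * π)) (hmeas : Measurable ψ) (hodd : Function.Odd ψ)
    (hpos : 0 < cellNormSq ψ) (hfin : cellNormSq ψ < ∞) (hq : boltzmannForm ω₂ a b ψ = 0) :
    ¬ HasOddSectorGap ω₂ a b := by
  rintro ⟨g, hg, h⟩
  exact no_gap_of_null hg hpos hq (h ψ hper hmeas hodd hfin)

/-- In particular an odd collisional invariant in `L²` of positive norm refutes the gap (for every
vertex), via `boltzmannForm_eq_zero_of_isCollisionalInvariant`. -/
theorem not_hasOddSectorGap_of_odd_invariant {ω₂ : ℝ} (a b : ℝ) {ψ : ℝ → ℝ}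
    (hψ : IsCollisionalInvariant ω₂ ψ) (hper : Function.Periodic ψ (2 * π)) (hmeas : Measurable ψ)
    (hodd : Function.Odd ψ) (hpos : 0 < cellNormSq ψ) (hfin : cellNormSq ψ < ∞) :
    ¬ HasOddSectorGap ω₂ a b :=
  not_hasOddSectorGap_of_odd_null hper hmeas hodd hpos hfin
    (boltzmannForm_eq_zero_of_isCollisionalInvariant a b hψ)

/-- Contrapositive, the form provers quote: **the crux implies that every odd `2π`-periodic
measurable `L²` collisional invariant of the pinned band has norm zero**, at every `ω₂ > 0`
(route KineticCorner's `NoOddCollisionalInvariant`, a.e. form). -/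
theorem cellNormSq_eq_zero_of_crux
    (h : Summit.AtomisticToContinuum.FouriersLaw.Theses.EmbeddedDrudeMourre.FGRGap)
    {ω₂ : ℝ} (hω : 0 < ω₂) {ψ : ℝ → ℝ} (hψ : IsCollisionalInvariant ω₂ ψ)
    (hper : Function.Periodic ψ (2 * π)) (hmeas : Measurable ψ) (hodd : Function.Odd ψ)
    (hfin : cellNormSq ψ < ∞) : cellNormSq ψ = 0 := by
  by_contra hne
  have hpos : 0 < cellNormSq ψ := pos_iff_ne_zero.mpr hne
  exact not_hasOddSectorGap_of_odd_invariant 1 1 hψ hper hmeas hodd hpos hfin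
    (h ω₂ 1 1 hω one_pos one_pos)

/-! ## 2. Load-bearing hypotheses: each one dropped gives a FALSE statement -/

/-- The gap property with the PERIODICITY hypothesis on `f` dropped. -/
def HasOddSectorGapWithoutPeriodic (ω₂ a b : ℝ) : Prop :=
  ∃ g : ℝ, 0 < g ∧ ∀ f : ℝ → ℝ, Measurable f → Function.Odd f →
    cellNormSq f < ∞ → ENNReal.ofReal g * cellNormSq f ≤ boltzmannForm ω₂ a b f

/-- Crystal momentum `k ↦ k` (not a function on the torus) is an exact null vector of the typed
form: its bracket `k₁ + k₂ - k₃ - (k₁ + k₂ - k₃)` vanishes identically (momentum conservation is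
built into the parametrisation; umklapp is invisible to a non-periodic `f`). -/
theorem boltzmannForm_id (ω₂ a b : ℝ) : boltzmannForm ω₂ a b (fun k => k) = 0 := by
  unfold boltzmannForm
  simp

/-- **Periodicity is load-bearing**: without it the odd `L²` function `k ↦ k` is a null vector,
for every `ω₂, a, b`. Any proof must use that `f` lives on the torus (umklapp). -/
theorem hasOddSectorGapWithoutPeriodic_false (ω₂ a b : ℝ) :
    ¬ HasOddSectorGapWithoutPeriodic ω₂ a b := by
  rintro ⟨g, hg, h⟩
  exact no_gap_of_null hg cellNormSq_id_pos (boltzmannForm_id ω₂ a b)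
    (h (fun k => k) measurable_id (fun _ => rfl) cellNormSq_id_lt_top)

/-- The gap property with the ODDNESS hypothesis dropped. -/
def HasOddSectorGapWithoutOdd (ω₂ a b : ℝ) : Prop :=
  ∃ g : ℝ, 0 < g ∧ ∀ f : ℝ → ℝ, Function.Periodic f (2 * π) → Measurable f →
    cellNormSq f < ∞ → ENNReal.ofReal g * cellNormSq f ≤ boltzmannForm ω₂ a b f

/-- `q(1) = 0` (phonon number). -/
theorem boltzmannForm_one (ω₂ a b : ℝ) : boltzmannForm ω₂ a b (fun _ => (1 : ℝ)) = 0 := by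
  simpa using boltzmannForm_const_add_mul_dispersion ω₂ a b 1 0

/-- **Oddness is load-bearing**: the even invariants `1, ω` are null vectors
(`boltzmannForm_const_add_mul_dispersion`); witness `1`. -/
theorem hasOddSectorGapWithoutOdd_false (ω₂ a b : ℝ) : ¬ HasOddSectorGapWithoutOdd ω₂ a b := by
  rintro ⟨g, hg, h⟩
  have hpos : 0 < cellNormSq (fun _ => (1 : ℝ)) := by
    rw [cellNormSq_one]; simpa using Real.pi_pos
  exact no_gap_of_null hg hpos (boltzmannForm_one ω₂ a b)
    (h (fun _ => 1) (fun _ => rfl) measurable_const (by rw [cellNormSq_one]; exact ENNReal.ofReal_lt_top))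

/-- The crux with the hypothesis `0 < ω₂` dropped. -/
def CruxWithoutOmegaPos : Prop :=
  ∀ ω₂ a b : ℝ, 0 < a → 0 < b → HasOddSectorGap ω₂ a b

/-- For `ω₂ ≤ -4` the typed band is the junk constant `0` (`Real.sqrt` of a non-positive number). -/
theorem dispersion_eq_zero_of_le {ω₂ : ℝ} (hω : ω₂ ≤ -4) (k : ℝ) : dispersion ω₂ k = 0 := by
  unfold dispersion
  apply Real.sqrt_eq_zero'.mpr
  have := Real.neg_one_le_cos k
  linarith

/-- … hence every collision weight is the junk `x / 0 = 0` … -/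
theorem collisionWeight_eq_zero_of_le {ω₂ : ℝ} (hω : ω₂ ≤ -4) (a b k₁ k₂ k₃ : ℝ) :
    collisionWeight ω₂ a b k₁ k₂ k₃ = 0 := by
  unfold collisionWeight
  simp [dispersion_eq_zero_of_le hω]

/-- … and the form vanishes identically. -/
theorem boltzmannForm_eq_zero_of_le {ω₂ : ℝ} (hω : ω₂ ≤ -4) (a b : ℝ) (f : ℝ → ℝ) :
    boltzmannForm ω₂ a b f = 0 := by
  unfold boltzmannForm
  simp [collisionWeight_eq_zero_of_le hω]

/-- `sin` is an admissible odd test function of positive finite norm; it refutes any gap claim for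
a form that vanishes identically. -/
theorem not_hasOddSectorGap_of_form_zero {ω₂ a b : ℝ}
    (h0 : ∀ f : ℝ → ℝ, boltzmannForm ω₂ a b f = 0) : ¬ HasOddSectorGap ω₂ a b :=
  not_hasOddSectorGap_of_odd_null Real.sin_periodic Real.measurable_sin (fun k => Real.sin_neg k)
    cellNormSq_sin_pos cellNormSq_sin_lt_top (h0 Real.sin)

/-- **`0 < ω₂` is load-bearing as typed** (junk regime, not physics): at `ω₂ = -4` the band,
the weights and the form are all `0`, so `HasOddSectorGap (-4) a b` fails for every vertex. The
physically meaningful boundary case `ω₂ = 0` (acoustic FPU-type band, no gap expected by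
Jäckle 1970 / LS08 Lemma 4.1 in THEIR normalisation) is not decided by this cheap argument: the
typed weight carries `(ω₁ω₂ω₃ω₄)⁻²`, which diverges at `k = 0` when `ω₂ = 0`. -/
theorem cruxWithoutOmegaPos_false : ¬ CruxWithoutOmegaPos := fun h =>
  not_hasOddSectorGap_of_form_zero (boltzmannForm_eq_zero_of_le (le_refl (-4)) 1 1)
    (h (-4) 1 1 one_pos one_pos)

/-- The crux with BOTH coupling hypotheses `0 < a`, `0 < b` dropped. -/
def CruxWithoutCouplings : Prop :=
  ∀ ω₂ a b : ℝ, 0 < ω₂ → HasOddSectorGap ω₂ a b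

/-- Harmonic chain: the vertex `Φ_{0,0}` vanishes, so does every weight and the form. -/
theorem boltzmannForm_zero_zero (ω₂ : ℝ) (f : ℝ → ℝ) : boltzmannForm ω₂ 0 0 f = 0 := by
  unfold boltzmannForm collisionWeight vertex
  simp

/-- **`(a, b) ≠ (0, 0)` is load-bearing**: the harmonic chain `a = b = 0` has `q ≡ 0`
(infinitely many odd conserved quantities; ballistic transport). Which of `0 < a`, `0 < b` is
really needed: numerically `0 < a` IS (the `a = 0` slice is gapless: odd bumps at `k = 0`, where
`Φ_{0,b} ∝ sin(k₁/2)` kills the grazing collision rate, have quotient `→ 0`), `0 < b` is NOT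
(`b = 0` is ALS's on-site model, Galerkin bottom `5.52e-3` at `ω₂ = 1`); see §4 and the docblock. -/
theorem cruxWithoutCouplings_false : ¬ CruxWithoutCouplings := fun h =>
  not_hasOddSectorGap_of_form_zero (boltzmannForm_zero_zero 1) (h 1 0 0 one_pos)

/-! ## 3. Normal forms of the crux (what a disproof may assume) -/

/-- Couplings scale out: `HasOddSectorGap ω₂ (εa) (εb) ↔ HasOddSectorGap ω₂ a b` for `ε ≠ 0`
(`q_{εa,εb} = ε² q_{a,b}`, `boltzmannForm_smul`). Only the ratio `b/a` and `ω₂` matter. -/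
theorem hasOddSectorGap_smul_iff {ω₂ a b ε : ℝ} (hε : ε ≠ 0) :
    HasOddSectorGap ω₂ (ε * a) (ε * b) ↔ HasOddSectorGap ω₂ a b := by
  have key : ∀ {a b ε : ℝ}, ε ≠ 0 → HasOddSectorGap ω₂ (ε * a) (ε * b) → HasOddSectorGap ω₂ a b := by
    intro a b ε hε ⟨g, hg, h⟩
    have hε2 : 0 < ε ^ 2 := by positivity
    refine ⟨g / ε ^ 2, div_pos hg hε2, fun f hper hmeas hodd hfin => ?_⟩
    have H := h f hper hmeas hodd hfin
    rw [boltzmannForm_smul] at H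
    rw [ENNReal.ofReal_div_of_pos hε2, ENNReal.div_eq_inv_mul, mul_assoc]
    rw [ENNReal.inv_mul_le_iff (by simpa using hε2.ne') ENNReal.ofReal_ne_top]
    exact H
  refine ⟨key hε, fun h => ?_⟩
  have h' : HasOddSectorGap ω₂ (ε⁻¹ * (ε * a)) (ε⁻¹ * (ε * b)) := by
    rwa [← mul_assoc, ← mul_assoc, inv_mul_cancel₀ hε, one_mul, one_mul]
  exact key (inv_ne_zero hε) h'

/-- **One-parameter normal form**: the crux is the statement for the vertex `Φ = 1 + 16 r ∏ sin`,
`r = b/a > 0`, at every `ω₂ > 0`. -/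
theorem crux_iff_unit_onsite :
    Summit.AtomisticToContinuum.FouriersLaw.Theses.EmbeddedDrudeMourre.FGRGap ↔
      ∀ ω₂ r : ℝ, 0 < ω₂ → 0 < r → HasOddSectorGap ω₂ 1 r := by
  constructor
  · intro h ω₂ r hω hr
    exact h ω₂ 1 r hω one_pos hr
  · intro h ω₂ a b hω ha hb
    have h1 := h ω₂ (b / a) hω (div_pos hb ha)
    have h2 := (hasOddSectorGap_smul_iff (ε := a) ha.ne').mpr h1
    rwa [mul_one, mul_div_cancel₀ _ ha.ne'] at h2

/-! ## 4. Finiteness of the resonant sets off the diagonal (analyticity) -/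

/-- The real square root is real-analytic on `(0, ∞)` (`√t = exp(log t / 2)`). [folklore] -/
theorem analyticAt_sqrt {t : ℝ} (ht : 0 < t) : AnalyticAt ℝ Real.sqrt t := by
  have h : AnalyticAt ℝ (fun τ : ℝ => Real.exp (Real.log τ / 2)) t := by
    fun_prop (disch := assumption)
  refine h.congr ?_
  filter_upwards [Ioi_mem_nhds ht] with τ hτ
  rw [Real.sqrt_eq_rpow, Real.rpow_def_of_pos hτ]
  congr 1; ring

/-- The pinned band is real-analytic (`ω₂ > 0`: the radicand is `≥ ω₂ > 0`). [folklore] -/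
theorem analyticAt_dispersion {ω₂ : ℝ} (hω : 0 < ω₂) (k : ℝ) : AnalyticAt ℝ (dispersion ω₂) k := by
  have hpos : 0 < ω₂ + 2 * (1 - Real.cos k) := by
    have := two_mul_one_sub_cos_nonneg k
    linarith
  have hin : AnalyticAt ℝ (fun k : ℝ => ω₂ + 2 * (1 - Real.cos k)) k := by fun_prop
  have h := (analyticAt_sqrt hpos).comp_of_eq hin rfl
  unfold dispersion
  exact h

/-- `k₂ ↦ Ω(k₁, k₂, k₃)` is real-analytic on `ℝ`. [folklore] -/
theorem analyticAt_resonanceFn {ω₂ : ℝ} (hω : 0 < ω₂) (k₁ k₃ k₂ : ℝ) :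
    AnalyticAt ℝ (fun q => resonanceFn ω₂ k₁ q k₃) k₂ := by
  unfold resonanceFn
  have h2 := analyticAt_dispersion hω k₂
  have hin : AnalyticAt ℝ (fun q : ℝ => k₁ + q - k₃) k₂ := by fun_prop
  have h4 : AnalyticAt ℝ (fun q => dispersion ω₂ (k₁ + q - k₃)) k₂ :=
    (analyticAt_dispersion hω (k₁ + k₂ - k₃)).comp_of_eq hin rfl
  exact ((analyticAt_const.add h2).sub analyticAt_const).sub h4

/-- `ω(c) = ω(0)` forces `c ∈ 2πℤ` (the band has minimal period `2π`). [folklore] -/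
theorem exists_int_of_dispersion_eq {ω₂ c : ℝ} (hω : 0 ≤ ω₂)
    (h : dispersion ω₂ c = dispersion ω₂ 0) : ∃ n : ℤ, c = n * (2 * π) := by
  have h1 := congrArg (· ^ 2) h
  simp only [dispersion_sq hω, Real.cos_zero] at h1
  have hc : Real.cos c = 1 := by linarith
  obtain ⟨n, hn⟩ := (Real.cos_eq_one_iff c).mp hc
  exact ⟨n, hn.symm⟩

/-- If `Ω(k₁, ·, k₃)` vanishes identically then `k₁ - k₃ ∈ 2πℤ` (the diagonal of the chart):
`g(k₂) = ω(k₂) - ω(k₂ + c)` would be constant, `= g(-c/2) = 0` by evenness, whence `ω` is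
`c`-periodic. [folklore] -/
theorem exists_int_of_resonanceFn_eq_zero {ω₂ : ℝ} (hω : 0 ≤ ω₂) {k₁ k₃ : ℝ}
    (h : ∀ k₂, resonanceFn ω₂ k₁ k₂ k₃ = 0) : ∃ n : ℤ, k₁ - k₃ = n * (2 * π) := by
  have hA := h (-(k₁ - k₃) / 2)
  have hB := h 0
  unfold resonanceFn at hA hB
  have e1 : k₁ + -(k₁ - k₃) / 2 - k₃ = (k₁ - k₃) / 2 := by ring
  have e2 : -(k₁ - k₃) / 2 = -((k₁ - k₃) / 2) := by ring
  rw [e1, e2, dispersion_neg] at hA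
  have e3 : k₁ + 0 - k₃ = k₁ - k₃ := by ring
  rw [e3] at hB
  -- hA : ω₁ + ω(c/2) - ω₃ - ω(c/2) = 0 ⇒ ω₁ = ω₃ ; hB : ω₁ + ω 0 - ω₃ - ω c = 0 ⇒ ω c = ω 0
  apply exists_int_of_dispersion_eq hω
  linarith

/-- **Off the diagonal the resonant set is finite**: for `k₁ - k₃ ∉ 2πℤ` the zeros of the
non-identically-vanishing real-analytic periodic function `k₂ ↦ Ω(k₁,k₂,k₃)` in `(-π, π]` are
finitely many (identity theorem + compactness). This is what makes the `finsum` in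
`boltzmannForm` a genuine finite sum for a.e. `(k₁, k₃)`. [folklore] -/
theorem resonantSet_finite {ω₂ : ℝ} (hω : 0 < ω₂) {k₁ k₃ : ℝ}
    (hc : ∀ n : ℤ, k₁ - k₃ ≠ n * (2 * π)) : (resonantSet ω₂ k₁ k₃).Finite := by
  by_contra hinf
  have hsub : resonantSet ω₂ k₁ k₃ ⊆ Icc (-π) π := fun k hk => ⟨hk.1.1.le, hk.1.2⟩
  obtain ⟨x, -, hx⟩ := Set.Infinite.exists_accPt_of_subset_isCompact hinf isCompact_Icc hsub
  have hfr : ∃ᶠ y in 𝓝[≠] x, resonanceFn ω₂ k₁ y k₃ = 0 :=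
    (accPt_iff_frequently_nhdsNE.mp hx).mono fun y hy => hy.2
  have han : AnalyticOnNhd ℝ (fun q => resonanceFn ω₂ k₁ q k₃) univ :=
    fun q _ => analyticAt_resonanceFn hω k₁ k₃ q
  have h0 := han.eqOn_zero_of_preconnected_of_frequently_eq_zero isPreconnected_univ
    (mem_univ x) hfr
  obtain ⟨n, hn⟩ := exists_int_of_resonanceFn_eq_zero hω.le (k₁ := k₁) (k₃ := k₃)
    fun k₂ => h0 (mem_univ k₂)
  exact hc n hn

/-! ## 5. Monotonicity of the form in the collision weight; the vertex is a bounded perturbation -/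

/-- For `2π`-periodic `f` the bracket vanishes on the diagonal `k₁ - k₃ ∈ 2πℤ`, for every `k₂`
(there the resonant set is all of `(-π, π]` and the `finsum` is junk `0` anyway). [folklore] -/
theorem bracket_eq_zero_of_diag {f : ℝ → ℝ} (hf : Function.Periodic f (2 * π)) {k₁ k₃ : ℝ}
    {n : ℤ} (hn : k₁ - k₃ = n * (2 * π)) (k₂ : ℝ) :
    f k₁ + f k₂ - f k₃ - f (k₁ + k₂ - k₃) = 0 := by
  have h1 : f k₁ = f k₃ := by
    rw [show k₁ = k₃ + n * (2 * π) by linarith]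
    exact hf.int_mul n k₃
  have h2 : f (k₁ + k₂ - k₃) = f k₂ := by
    rw [show k₁ + k₂ - k₃ = k₂ + n * (2 * π) by linarith]
    exact hf.int_mul n k₂
  linarith

/-- **The form is monotone in the weight** (on periodic `f`): a pointwise bound
`w_{a,b} ≤ C · w_{a',b'}` of the collision kernels gives `q_{a,b}(f) ≤ C · q_{a',b'}(f)`. Uses
`resonantSet_finite` off the diagonal (so that the `finsum`s are finite sums) and the vanishing
of the bracket on it. [folklore] -/
theorem boltzmannForm_mono_weight {ω₂ : ℝ} (hω : 0 < ω₂) {a b a' b' C : ℝ} (hC : 0 ≤ C)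
    (hw : ∀ k₁ k₂ k₃, collisionWeight ω₂ a b k₁ k₂ k₃ ≤ C * collisionWeight ω₂ a' b' k₁ k₂ k₃)
    {f : ℝ → ℝ} (hf : Function.Periodic f (2 * π)) :
    boltzmannForm ω₂ a b f ≤ ENNReal.ofReal C * boltzmannForm ω₂ a' b' f := by
  unfold boltzmannForm
  rw [← mul_assoc, mul_comm (ENNReal.ofReal C), mul_assoc]
  gcongr
  rw [← lintegral_const_mul' _ _ ENNReal.ofReal_ne_top]
  apply lintegral_mono
  intro k₁
  dsimp only
  rw [← lintegral_const_mul' _ _ ENNReal.ofReal_ne_top]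
  apply lintegral_mono
  intro k₃
  dsimp only
  rw [← ENNReal.ofReal_mul hC]
  apply ENNReal.ofReal_le_ofReal
  by_cases hdiag : ∃ n : ℤ, k₁ - k₃ = n * (2 * π)
  · obtain ⟨n, hn⟩ := hdiag
    have hz : ∀ k₂, f k₁ + f k₂ - f k₃ - f (k₁ + k₂ - k₃) = 0 := bracket_eq_zero_of_diag hf hn
    simp [hz]
  · push Not at hdiag
    have hfin := resonantSet_finite hω hdiag
    rw [finsum_mem_eq_finite_toFinset_sum _ hfin, finsum_mem_eq_finite_toFinset_sum _ hfin,
      Finset.mul_sum]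
    apply Finset.sum_le_sum
    intro k₂ _
    calc collisionWeight ω₂ a b k₁ k₂ k₃ * (f k₁ + f k₂ - f k₃ - f (k₁ + k₂ - k₃)) ^ 2
        ≤ C * collisionWeight ω₂ a' b' k₁ k₂ k₃ * (f k₁ + f k₂ - f k₃ - f (k₁ + k₂ - k₃)) ^ 2 :=
          mul_le_mul_of_nonneg_right (hw k₁ k₂ k₃) (sq_nonneg _)
      _ = _ := by ring

/-- Transfer of a gap constant along `g‖f‖² ≤ q ≤ C q'`. [folklore] -/
theorem gap_transfer {g C : ℝ} (hC : 0 < C) {N q q' : ℝ≥0∞}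
    (h1 : ENNReal.ofReal g * N ≤ q) (h2 : q ≤ ENNReal.ofReal C * q') :
    ENNReal.ofReal (g / C) * N ≤ q' := by
  rw [ENNReal.ofReal_div_of_pos hC, ENNReal.div_eq_inv_mul, mul_assoc,
    ENNReal.inv_mul_le_iff (by simpa using hC) ENNReal.ofReal_ne_top]
  exact h1.trans h2

/-- **Gap transfer between vertices**: if `w_{a',b'} ≤ C w_{a,b}` pointwise (`C > 0`), a gap for
`(a', b')` is inherited… no: a gap for `(a, b)` needs the OTHER direction. Precisely: a gap for
the SMALLER kernel's form passes to the larger one. [folklore] -/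
theorem hasOddSectorGap_of_weight_le {ω₂ : ℝ} (hω : 0 < ω₂) {a b a' b' C : ℝ} (hC : 0 < C)
    (hw : ∀ k₁ k₂ k₃, collisionWeight ω₂ a b k₁ k₂ k₃ ≤ C * collisionWeight ω₂ a' b' k₁ k₂ k₃)
    (h : HasOddSectorGap ω₂ a b) : HasOddSectorGap ω₂ a' b' := by
  obtain ⟨g, hg, h⟩ := h
  refine ⟨g / C, div_pos hg hC, fun f hper hmeas hodd hfin => ?_⟩
  exact gap_transfer hC (h f hper hmeas hodd hfin) (boltzmannForm_mono_weight hω hC.le hw hper)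

/-- `|∏ sin(k_j/2)| ≤ 1`. [folklore] -/
theorem abs_sin_prod_le_one (k₁ k₂ k₃ : ℝ) :
    |Real.sin (k₁ / 2) * Real.sin (k₂ / 2) * Real.sin (k₃ / 2) * Real.sin ((k₁ + k₂ - k₃) / 2)| ≤ 1 := by
  rw [abs_mul, abs_mul, abs_mul]
  have h1 := Real.abs_sin_le_one (k₁ / 2)
  have h2 := Real.abs_sin_le_one (k₂ / 2)
  have h3 := Real.abs_sin_le_one (k₃ / 2)
  have h4 := Real.abs_sin_le_one ((k₁ + k₂ - k₃) / 2)
  have h12 : |Real.sin (k₁ / 2)| * |Real.sin (k₂ / 2)| ≤ 1 := mul_le_one₀ h1 (abs_nonneg _) h2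
  have h123 : |Real.sin (k₁ / 2)| * |Real.sin (k₂ / 2)| * |Real.sin (k₃ / 2)| ≤ 1 :=
    mul_le_one₀ h12 (abs_nonneg _) h3
  exact mul_le_one₀ h123 (abs_nonneg _) h4

/-- The vertex is between `a - 16b` and `a + 16b` (`b ≥ 0`). [folklore] -/
theorem vertex_mem_Icc {a b : ℝ} (hb : 0 ≤ b) (k₁ k₂ k₃ : ℝ) :
    vertex a b k₁ k₂ k₃ ∈ Icc (a - 16 * b) (a + 16 * b) := by
  unfold vertex
  have h := abs_le.mp (abs_sin_prod_le_one k₁ k₂ k₃)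
  constructor <;> nlinarith [h.1, h.2]

/-- `Φ_{a,b}² ≤ (a + 16b)²` for `a, b ≥ 0`. [folklore] -/
theorem vertex_sq_le {a b : ℝ} (ha : 0 ≤ a) (hb : 0 ≤ b) (k₁ k₂ k₃ : ℝ) :
    vertex a b k₁ k₂ k₃ ^ 2 ≤ (a + 16 * b) ^ 2 := by
  have h := vertex_mem_Icc hb k₁ k₂ k₃ (a := a)
  apply sq_le_sq'
  · linarith [h.1]
  · exact h.2

/-- `(a - 16b)² ≤ Φ_{a,b}²` on the cone `16b ≤ a`, `b ≥ 0`. [folklore] -/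
theorem le_vertex_sq {a b : ℝ} (hb : 0 ≤ b) (hab : 16 * b ≤ a) (k₁ k₂ k₃ : ℝ) :
    (a - 16 * b) ^ 2 ≤ vertex a b k₁ k₂ k₃ ^ 2 := by
  have h := vertex_mem_Icc hb k₁ k₂ k₃ (a := a)
  exact pow_le_pow_left₀ (by linarith) h.1 2

/-- The couplings enter the kernel only through `Φ²`: `w_{a,b} = Φ_{a,b}² · w_{1,0}`. [folklore] -/
theorem collisionWeight_eq_vertex_sq_mul (ω₂ a b k₁ k₂ k₃ : ℝ) :
    collisionWeight ω₂ a b k₁ k₂ k₃ = vertex a b k₁ k₂ k₃ ^ 2 * collisionWeight ω₂ 1 0 k₁ k₂ k₃ := by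
  unfold collisionWeight
  have hv : vertex 1 0 k₁ k₂ k₃ = 1 := by unfold vertex; ring
  rw [hv]
  ring

/-! ## 6. Reduction of the crux to / from ALS's on-site model `b = 0` -/

/-- **The on-site (ALS, `b = 0`) gap is NECESSARY**: a gap at any `(a, b)` with `a, b ≥ 0`,
`a + 16b > 0` gives the gap of the pure on-site vertex (any `a' > 0`), with constant
`g · (a'/(a+16b))²`. So a disproof may forget `b` altogether: refuting
`∀ ω₂ > 0, HasOddSectorGap ω₂ 1 0` refutes the crux (`onsite_of_crux`). [folklore] -/
theorem hasOddSectorGap_onsite_of_gap {ω₂ a b : ℝ} (hω : 0 < ω₂) (ha : 0 ≤ a) (hb : 0 ≤ b)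
    (hab : 0 < a + 16 * b) (h : HasOddSectorGap ω₂ a b) {a' : ℝ} (ha' : 0 < a') :
    HasOddSectorGap ω₂ a' 0 := by
  refine hasOddSectorGap_of_weight_le hω (C := ((a + 16 * b) / a') ^ 2) (by positivity) ?_ h
  intro k₁ k₂ k₃
  rw [collisionWeight_eq_vertex_sq_mul ω₂ a b, collisionWeight_eq_vertex_sq_mul ω₂ a' 0]
  have hv' : vertex a' 0 k₁ k₂ k₃ = a' := by unfold vertex; ring
  rw [hv', ← mul_assoc]
  apply mul_le_mul_of_nonneg_right _ (collisionWeight_nonneg ω₂ 1 0 k₁ k₂ k₃)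
  calc vertex a b k₁ k₂ k₃ ^ 2 ≤ (a + 16 * b) ^ 2 := vertex_sq_le ha hb k₁ k₂ k₃
    _ = ((a + 16 * b) / a') ^ 2 * a' ^ 2 := by field_simp

/-- **… and SUFFICIENT on the cone `16b < a`**: there `Φ_{a,b} ≥ a - 16b > 0` and the on-site gap
(any `a' > 0`) transfers with constant `g · ((a-16b)/a')²`. (On `a ≤ 16b` this crude comparison
fails; with the sharper range `∏ sin(k_j/2) ≥ -1/4` ON the resonant manifold, claimed numerically
by card grazing-jet-rigidity, the cone would widen to `4b < a`; for `a ≤ 4b` the vertex vanishes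
on a curve of the resonant manifold and no kernel comparison with `b = 0` can work, though the
grazing collisions, where `∏ sin(k_j/2) = sin²(k/2)sin²(k*/2) ≥ 0`, keep `Φ ≥ a`.) [folklore] -/
theorem hasOddSectorGap_of_onsite {ω₂ a' : ℝ} (hω : 0 < ω₂) (ha' : 0 < a')
    (h : HasOddSectorGap ω₂ a' 0) {a b : ℝ} (hb : 0 ≤ b) (hab : 16 * b < a) :
    HasOddSectorGap ω₂ a b := by
  have hpos : 0 < a - 16 * b := by linarith
  refine hasOddSectorGap_of_weight_le hω (C := (a' / (a - 16 * b)) ^ 2) (by positivity) ?_ h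
  intro k₁ k₂ k₃
  rw [collisionWeight_eq_vertex_sq_mul ω₂ a b, collisionWeight_eq_vertex_sq_mul ω₂ a' 0]
  have hv' : vertex a' 0 k₁ k₂ k₃ = a' := by unfold vertex; ring
  rw [hv', ← mul_assoc]
  apply mul_le_mul_of_nonneg_right _ (collisionWeight_nonneg ω₂ 1 0 k₁ k₂ k₃)
  calc a' ^ 2 = (a' / (a - 16 * b)) ^ 2 * (a - 16 * b) ^ 2 := by field_simp
    _ ≤ (a' / (a - 16 * b)) ^ 2 * vertex a b k₁ k₂ k₃ ^ 2 :=
        mul_le_mul_of_nonneg_left (le_vertex_sq hb hab.le k₁ k₂ k₃) (by positivity)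

/-- **Corollary (necessary condition).** The crux implies the odd-sector gap of ALS's on-site
quartic chain (`b = 0`, the model of AokiLukkarinenSpohn2006) at every `ω₂ > 0`. -/
theorem onsite_of_crux (h : Summit.AtomisticToContinuum.FouriersLaw.Theses.EmbeddedDrudeMourre.FGRGap)
    {ω₂ : ℝ} (hω : 0 < ω₂) : HasOddSectorGap ω₂ 1 0 :=
  hasOddSectorGap_onsite_of_gap hω zero_le_one zero_le_one (by norm_num) (h ω₂ 1 1 hω one_pos one_pos)
    one_pos

/-- **Corollary (partial converse).** The on-site gap at every `ω₂ > 0` gives the crux on the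
cone `0 ≤ 16b < a` (in particular the whole `b = 0` slice and all small `b/a`). -/
theorem crux_on_cone_of_onsite (h : ∀ ω₂ : ℝ, 0 < ω₂ → HasOddSectorGap ω₂ 1 0) {ω₂ a b : ℝ}
    (hω : 0 < ω₂) (hb : 0 ≤ b) (hab : 16 * b < a) : HasOddSectorGap ω₂ a b :=
  hasOddSectorGap_of_onsite hω one_pos (h ω₂ hω) hb hab


/-! ## 7. Refuted natural strengthenings / near-misses (numerical; `sorry` by design of this
work file — the witnesses are explicit but bounding `q` from ABOVE in Lean needs the resonant
geometry) -/

/-- **Near-miss / refuted weakening: the `a = 0` slice is gapless.** For the pure bond-quartic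
vertex `Φ_{0,b} = 16b∏ sin(k_j/2)` the grazing collision rate at momentum `k` carries
`sin²(k/2)`, which vanishes at `k = 0`; odd bumps `f_ε(k) = F(k/ε)`, `F(x) = x e^{-x²}`, have
`q(f_ε)/‖f_ε‖² = 0.0559, 0.0164, 0.00414, 0.00102` at `ε = 0.4, 0.2, 0.1, 0.05`
(`(ω₂,a,b) = (1,0,1)`; local slopes `1.77, 1.99, 2.02` ⇒ `≍ ε²`). So `0 < a` cannot be dropped
and any proof must use it quantitatively (`g ≲ C(ω₂,b)·a²` as `a → 0`). Obstruction to a Lean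
proof: an explicit UPPER bound on `boltzmannForm` of a bump (integrating `|∂₂Ω|⁻¹` over the
resonant curve). [numerical: num/packets.py] -/
theorem not_hasOddSectorGap_zero_onsite {ω₂ b : ℝ} (hω : 0 < ω₂) (hb : 0 < b) :
    ¬ HasOddSectorGap ω₂ 0 b := by
  sorry

/-- **Refuted strengthening: no gap constant uniform in `ω₂`** (none is claimed by the crux).
Galerkin bottoms `λ_min/π` of `q_{ω₂,1,0}` on odd trigonometric polynomials (upper bounds for the
true infimum): `0.294 (ω₂=0.05)`, `5.52e-3 (1)`, `4.44e-5 (4.47)`, `4.68e-8 (20)`, tail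
`∝ δ^{5.5}`; the soft modes are the odd `π`-periodic functions, exact invariants of the `δ = 0`
limiting resonance `k₁ + k₂ = π`. (As `ω₂ → 0` the bottom INCREASES — the typed weight `(∏ω)⁻²`
makes the near-acoustic regime MORE dissipative, so the Jäckle/LS08 no-gap intuition does not
transfer to this normalisation.) [numerical: num/scan.py] -/
theorem no_uniform_gap :
    ¬ ∃ g : ℝ, 0 < g ∧ ∀ ω₂ : ℝ, 0 < ω₂ → ∀ f : ℝ → ℝ, Function.Periodic f (2 * π) →
      Measurable f → Function.Odd f → cellNormSq f < ∞ →
        ENNReal.ofReal g * cellNormSq f ≤ boltzmannForm ω₂ 1 0 f := by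
  sorry


/-! ## 8. (cycle 2) The picked line `log-coercive-compact-resolvent`: its objects, and the load-bearing
additive constant `C` of log-coercivity / grazing decorrelation

The skeleton `Cruxes/FGRGap/Lines/log-coercive-compact-resolvent.lean` (6 registered stubs) is not an
importable module; the four objects below are VERBATIM copies of its definitions (same names, same
bodies — definitionally equal after `unfold`), so that facts about them can be kernel-checked here. -/

/-- (copy) The log-Sobolev (Gagliardo) functional `G(f) = ∫_cell dk ∫_{(-1,1)} dt (f(k+t) - f(k))²/|t|`. -/
def gagliardoLog (f : ℝ → ℝ) : ℝ≥0∞ :=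
  ∫⁻ k in Ioc (-π) π, ∫⁻ t in Ioo (-1 : ℝ) 1, ENNReal.ofReal ((f (k + t) - f k) ^ 2 / |t|)

/-- (copy) The grazing functional `Q_H(f)` of a partner map `H` on the strip `|t| < t₀`. -/
def grazingFunctional (H : ℝ → ℝ → ℝ) (t₀ : ℝ) (f : ℝ → ℝ) : ℝ≥0∞ :=
  ∫⁻ k in Ioc (-π) π, ∫⁻ t in Ioo (-t₀) t₀,
    ENNReal.ofReal ((f k + f (H k t) - f (k + t) - f (H k t - t)) ^ 2 / |t|)

/-- (copy) `H` is an a.e. selection of the grazing branch on the strip `|t| < t₀`. -/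
def IsGrazingBranch (ω₂ t₀ : ℝ) (H : ℝ → ℝ → ℝ) : Prop :=
  Measurable (Function.uncurry H) ∧
    ∀ᵐ p : ℝ × ℝ ∂(volume.restrict (Ioc (-π) π ×ˢ Ioo (-t₀) t₀)),
      H p.1 p.2 ∈ resonantSet ω₂ p.1 (p.1 + p.2) ∧
        (∀ n : ℤ, H p.1 p.2 - (p.1 + p.2) ≠ n * (2 * π)) ∧
          ∀ k₂ ∈ resonantSet ω₂ p.1 (p.1 + p.2),
            (∀ n : ℤ, k₂ - (p.1 + p.2) ≠ n * (2 * π)) → k₂ = H p.1 p.2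

/-- (copy) Log-coercivity of `q_{ω₂,a,b}`: `c·G(f) ≤ q(f) + C‖f‖²`. -/
def LogCoerciveAt (ω₂ a b : ℝ) : Prop :=
  ∃ c C : ℝ, 0 < c ∧ ∀ f : ℝ → ℝ, Function.Periodic f (2 * π) → Measurable f → cellNormSq f < ⊤ →
    ENNReal.ofReal c * gagliardoLog f ≤ boltzmannForm ω₂ a b f + ENNReal.ofReal C * cellNormSq f

/-- The band is measurable (indeed continuous). [folklore] -/
theorem measurable_dispersion (ω₂ : ℝ) : Measurable (dispersion ω₂) := by
  have hc : Continuous (dispersion ω₂) := by unfold dispersion; fun_prop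
  exact hc.measurable

/-- `‖ω‖² < ∞` on the cell (`ω² ≤ ω₂ + 4`). [folklore] -/
theorem cellNormSq_dispersion_lt_top {ω₂ : ℝ} (hω : 0 ≤ ω₂) : cellNormSq (dispersion ω₂) < ∞ := by
  unfold cellNormSq
  have h1 : ∫⁻ k in Ioc (-π) π, ENNReal.ofReal (dispersion ω₂ k ^ 2) ≤
      ∫⁻ _ in Ioc (-π) π, ENNReal.ofReal (ω₂ + 4) := by
    apply setLIntegral_mono measurable_const
    intro k _
    apply ENNReal.ofReal_le_ofReal
    rw [dispersion_sq hω]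
    have := Real.neg_one_le_cos k
    linarith
  rw [setLIntegral_const] at h1
  exact lt_of_le_of_lt h1 (ENNReal.mul_lt_top ENNReal.ofReal_lt_top (by simp))

/-- `q(ω) = 0` (energy is a collisional invariant). -/
theorem boltzmannForm_dispersion (ω₂ a b : ℝ) : boltzmannForm ω₂ a b (dispersion ω₂) = 0 := by
  have h := boltzmannForm_const_add_mul_dispersion ω₂ a b 0 1
  simp only [zero_add, one_mul] at h
  exact h

/-- The band is STRICTLY increasing on `[0, π]` (`ω₂ ≥ 0`). [folklore] -/
theorem dispersion_lt_dispersion {ω₂ : ℝ} (hω : 0 ≤ ω₂) {x y : ℝ} (hx : 0 ≤ x) (hxy : x < y)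
    (hy : y ≤ π) : dispersion ω₂ x < dispersion ω₂ y := by
  unfold dispersion
  have hcos : Real.cos y < Real.cos x :=
    Real.strictAntiOn_cos ⟨hx, by linarith⟩ ⟨by linarith, hy⟩ hxy
  apply Real.sqrt_lt_sqrt
  · have := two_mul_one_sub_cos_nonneg x
    linarith
  · linarith

/-- **`G(ω) > 0`**: the (even, smooth, non-constant) energy invariant has positive log-Sobolev
functional. Proof: the integrand is positive on the box `k ∈ (0,1]`, `t ∈ (0,1)` (strict
monotonicity of `ω` on `[0, π]`), whose measure is positive. [folklore] -/
theorem gagliardoLog_dispersion_pos {ω₂ : ℝ} (hω : 0 < ω₂) : 0 < gagliardoLog (dispersion ω₂) := by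
  unfold gagliardoLog
  set g : ℝ × ℝ → ℝ≥0∞ :=
    fun p => ENNReal.ofReal ((dispersion ω₂ (p.1 + p.2) - dispersion ω₂ p.1) ^ 2 / |p.2|) with hg
  have hmeas : Measurable g := by
    have hd := measurable_dispersion ω₂
    have h1 : Measurable fun p : ℝ × ℝ => (dispersion ω₂ (p.1 + p.2) - dispersion ω₂ p.1) ^ 2 / |p.2| :=
      (((hd.comp (measurable_fst.add measurable_snd)).sub (hd.comp measurable_fst)).pow_const 2).div
        (continuous_abs.measurable.comp measurable_snd)
    exact h1.ennreal_ofReal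
  change 0 < ∫⁻ k in Ioc (-π) π, ∫⁻ t in Ioo (-1 : ℝ) 1, g (k, t)
  have hsubk : Ioc (0 : ℝ) 1 ⊆ Ioc (-π) π := fun k hk =>
    ⟨by linarith [hk.1, Real.pi_pos], by linarith [hk.2, Real.pi_gt_three]⟩
  have hsubt : Ioo (0 : ℝ) 1 ⊆ Ioo (-1) 1 := fun t ht => ⟨by linarith [ht.1], ht.2⟩
  have hle : ∫⁻ k in Ioc (0 : ℝ) 1, ∫⁻ t in Ioo (0 : ℝ) 1, g (k, t) ≤
      ∫⁻ k in Ioc (-π) π, ∫⁻ t in Ioo (-1 : ℝ) 1, g (k, t) :=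
    calc ∫⁻ k in Ioc (0 : ℝ) 1, ∫⁻ t in Ioo (0 : ℝ) 1, g (k, t)
        ≤ ∫⁻ k in Ioc (0 : ℝ) 1, ∫⁻ t in Ioo (-1 : ℝ) 1, g (k, t) :=
          lintegral_mono fun k => lintegral_mono_set hsubt
      _ ≤ _ := lintegral_mono_set hsubk
  refine lt_of_lt_of_le ?_ hle
  have hpos : ∀ k ∈ Ioc (0 : ℝ) 1, ∀ t ∈ Ioo (0 : ℝ) 1, 0 < g (k, t) := by
    intro k hk t ht
    simp only [hg]
    rw [ENNReal.ofReal_pos]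
    apply div_pos _ (abs_pos.mpr ht.1.ne')
    have hlt : dispersion ω₂ k < dispersion ω₂ (k + t) :=
      dispersion_lt_dispersion hω.le hk.1.le (by linarith [ht.1])
        (by linarith [hk.2, ht.2, Real.pi_gt_three])
    have : 0 < dispersion ω₂ (k + t) - dispersion ω₂ k := by linarith
    positivity
  have hF : Measurable fun k => ∫⁻ t in Ioo (0 : ℝ) 1, g (k, t) := hmeas.lintegral_prod_right'
  have hFpos : ∀ k ∈ Ioc (0 : ℝ) 1, 0 < ∫⁻ t in Ioo (0 : ℝ) 1, g (k, t) := by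
    intro k hk
    rw [pos_iff_ne_zero]
    intro h0
    have hm : Measurable fun t => g (k, t) := hmeas.comp measurable_prodMk_left
    rw [lintegral_eq_zero_iff hm] at h0
    have hae : ∀ᵐ t ∂(volume : Measure ℝ), t ∉ Ioo (0 : ℝ) 1 := by
      rw [Filter.EventuallyEq, ae_restrict_iff' measurableSet_Ioo] at h0
      filter_upwards [h0] with t ht htmem
      exact (hpos k hk t htmem).ne' (ht htmem)
    have hvol : volume (Ioo (0 : ℝ) 1) = 0 := measure_eq_zero_iff_ae_notMem.mpr hae
    simp at hvol
  rw [pos_iff_ne_zero]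
  intro h0
  rw [lintegral_eq_zero_iff hF] at h0
  have hae : ∀ᵐ k ∂(volume : Measure ℝ), k ∉ Ioc (0 : ℝ) 1 := by
    rw [Filter.EventuallyEq, ae_restrict_iff' measurableSet_Ioc] at h0
    filter_upwards [h0] with k hk hkmem
    exact (hFpos k hkmem).ne' (hk hkmem)
  have hvol : volume (Ioc (0 : ℝ) 1) = 0 := measure_eq_zero_iff_ae_notMem.mpr hae
  simp at hvol

/-- **The additive constant `C` of log-coercivity is load-bearing**: `c·G(f) ≤ q(f)` with NO `C‖f‖²`
term is false for every `ω₂ > 0` and every vertex `(a, b)` — witness the energy invariant `ω`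
(`q(ω) = 0 < G(ω)`). So `LogCoerciveAt` cannot be sharpened to a homogeneous inequality, and the
low frequencies must be paid for (numerically `C ≈ 12–20` at `t₀ ∈ {½, ¼}`, see §9). -/
theorem not_logCoercive_without_C {ω₂ : ℝ} (hω : 0 < ω₂) (a b : ℝ) :
    ¬ ∃ c : ℝ, 0 < c ∧ ∀ f : ℝ → ℝ, Function.Periodic f (2 * π) → Measurable f →
      cellNormSq f < ⊤ → ENNReal.ofReal c * gagliardoLog f ≤ boltzmannForm ω₂ a b f := by
  rintro ⟨c, hc, h⟩
  have H := h (dispersion ω₂) (dispersion_periodic ω₂) (measurable_dispersion ω₂)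
    (cellNormSq_dispersion_lt_top hω.le)
  rw [boltzmannForm_dispersion] at H
  exact no_gap_of_null hc (gagliardoLog_dispersion_pos hω) rfl H

/-- **`Q_H(ω) = 0` for every a.e.-resonant partner map**: the bracket of `ω` along the branch is the
resonance function itself, `ω(k) + ω(H) - ω(k+t) - ω(H-t) = Ω(k, H, k+t) = 0`. (Only the resonance
clause of `IsGrazingBranch` is used.) -/
theorem grazingFunctional_dispersion_eq_zero {ω₂ t₀ : ℝ} {H : ℝ → ℝ → ℝ}
    (hres : ∀ᵐ p : ℝ × ℝ ∂(volume.restrict (Ioc (-π) π ×ˢ Ioo (-t₀) t₀)),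
      H p.1 p.2 ∈ resonantSet ω₂ p.1 (p.1 + p.2)) :
    grazingFunctional H t₀ (dispersion ω₂) = 0 := by
  unfold grazingFunctional
  rw [Measure.volume_eq_prod, ← Measure.prod_restrict] at hres
  have h2 := Measure.ae_ae_of_ae_prod hres
  have hinner : ∀ᵐ k ∂(volume.restrict (Ioc (-π) π)),
      (∫⁻ t in Ioo (-t₀) t₀, ENNReal.ofReal ((dispersion ω₂ k + dispersion ω₂ (H k t) -
        dispersion ω₂ (k + t) - dispersion ω₂ (H k t - t)) ^ 2 / |t|)) = 0 := by
    filter_upwards [h2] with k hk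
    have hz : (fun t => ENNReal.ofReal ((dispersion ω₂ k + dispersion ω₂ (H k t) -
        dispersion ω₂ (k + t) - dispersion ω₂ (H k t - t)) ^ 2 / |t|)) =ᵐ[volume.restrict (Ioo (-t₀) t₀)]
        fun _ => 0 := by
      filter_upwards [hk] with t ht
      have hr := ht.2
      unfold resonanceFn at hr
      have e : k + H k t - (k + t) = H k t - t := by ring
      rw [e] at hr
      simp [hr]
    rw [lintegral_congr_ae hz, lintegral_zero]
  rw [lintegral_congr_ae hinner, lintegral_zero]

/-- **The constant `C` of STUB 2 (`stub_grazingDecorrelation`) is load-bearing**: for every `ω₂ > 0`,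
every `t₀` and EVERY grazing branch `H`, the homogeneous inequality `c·G(f) ≤ Q_H(f)` fails (witness
`ω`: `Q_H(ω) = 0 < G(ω)`). The stub itself (with `+ C‖f‖²`) is NOT refuted — §9 finds it numerically
true with marginal constant `c* ≈ 1`. -/
theorem no_grazingDecorrelation_without_C {ω₂ t₀ : ℝ} (hω : 0 < ω₂) {H : ℝ → ℝ → ℝ}
    (hH : IsGrazingBranch ω₂ t₀ H) :
    ¬ ∃ c : ℝ, 0 < c ∧ ∀ f : ℝ → ℝ, Function.Periodic f (2 * π) → Measurable f →
      cellNormSq f < ⊤ → ENNReal.ofReal c * gagliardoLog f ≤ grazingFunctional H t₀ f := by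
  rintro ⟨c, hc, h⟩
  have Hω := h (dispersion ω₂) (dispersion_periodic ω₂) (measurable_dispersion ω₂)
    (cellNormSq_dispersion_lt_top hω.le)
  rw [grazingFunctional_dispersion_eq_zero (hH.2.mono fun p hp => hp.1)] at Hω
  exact no_gap_of_null hc (gagliardoLog_dispersion_pos hω) rfl Hω

/-! ## 8b. (cycle 2) The quantitative inputs of STUB 1 (`stub_grazingLowerBound`), kernel-checked:
vertex `Φ ≥ a − bt²` on the strip (product-to-sum, no case analysis, no restriction on `k, H`), Jacobian
`|∂₂Ω| ≤ L(ω₂)|t|` for EVERY partner (mean value theorem, `L = 1/√ω₂ + 1/√ω₂³`), `(∏ω)² ≤ (ω₂+4)⁴`, hence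
`w(k,H,k+t) ≥ (9/16π)(a/2)²(ω₂+4)⁻⁴/(L|t|)` wherever the Jacobian is non-zero and `bt² ≤ a/2`.  These are
items (ii)–(iii) of the stub's docstring; what remains branch-specific is only resonance / non-triviality /
a.e.-uniqueness of `H` (cf. §9a) and the measure-theoretic plumbing. -/

/-- Product-to-sum lower bound: `sin(x/2)·sin((x+t)/2) = (cos(t/2) - cos(x+t/2))/2 ≥ -t²/16`. [folklore] -/
theorem neg_sq_le_sin_half_mul_sin_half (x t : ℝ) :
    -(t ^ 2 / 16) ≤ Real.sin (x / 2) * Real.sin ((x + t) / 2) := by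
  have h : Real.sin (x / 2) * Real.sin ((x + t) / 2) =
      (Real.cos (t / 2) - Real.cos (x + t / 2)) / 2 := by
    have h1 := Real.cos_sub (x / 2) ((x + t) / 2)
    have h2 := Real.cos_add (x / 2) ((x + t) / 2)
    have e1 : x / 2 - (x + t) / 2 = -(t / 2) := by ring
    have e2 : x / 2 + (x + t) / 2 = x + t / 2 := by ring
    rw [e1, Real.cos_neg] at h1
    rw [e2] at h2
    linarith
  rw [h]
  have hc := Real.one_sub_sq_div_two_le_cos (x := t / 2)
  have hle := Real.cos_le_one (x + t / 2)
  nlinarith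

/-- If `S₁, S₂ ≥ -c` (`c ≥ 0`) and `S₁, S₂ ≤ 1` then `S₁S₂ ≥ -c`. [folklore] -/
theorem neg_le_mul_of_bounds {S₁ S₂ c : ℝ} (hc : 0 ≤ c) (h1 : -c ≤ S₁) (h2 : -c ≤ S₂) (b1 : S₁ ≤ 1)
    (b2 : S₂ ≤ 1) : -c ≤ S₁ * S₂ := by
  rcases le_or_gt 0 S₁ with p1 | n1 <;> rcases le_or_gt 0 S₂ with p2 | n2
  · nlinarith
  · nlinarith
  · nlinarith
  · nlinarith

/-- **Vertex lower bound on the grazing strip (input (iii) of STUB 1, no restriction on `k, H, t`)**: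
for `b ≥ 0`, `Φ_{a,b}(k, H, k+t) ≥ a - b t²` — the form factor `∏ sin(k_j/2)` of the collision
`(k, H) → (k+t, H-t)` is `≥ -t²/16`. [folklore] -/
theorem vertex_ge_on_strip {a b : ℝ} (hb : 0 ≤ b) (k H t : ℝ) :
    a - b * t ^ 2 ≤ vertex a b k H (k + t) := by
  unfold vertex
  have e : (k + H - (k + t)) / 2 = (H + -t) / 2 := by ring
  rw [e]
  have h1 := neg_sq_le_sin_half_mul_sin_half k t
  have h2 := neg_sq_le_sin_half_mul_sin_half H (-t)
  rw [neg_sq] at h2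
  have b1 : Real.sin (k / 2) * Real.sin ((k + t) / 2) ≤ 1 := by
    have := Real.abs_sin_le_one (k / 2)
    have := Real.abs_sin_le_one ((k + t) / 2)
    nlinarith [abs_le.mp ‹|Real.sin (k / 2)| ≤ 1›, abs_le.mp ‹|Real.sin ((k + t) / 2)| ≤ 1›,
      sq_nonneg (Real.sin (k / 2) - Real.sin ((k + t) / 2))]
  have b2 : Real.sin (H / 2) * Real.sin ((H + -t) / 2) ≤ 1 := by
    have := Real.abs_sin_le_one (H / 2)
    have := Real.abs_sin_le_one ((H + -t) / 2)
    nlinarith [abs_le.mp ‹|Real.sin (H / 2)| ≤ 1›, abs_le.mp ‹|Real.sin ((H + -t) / 2)| ≤ 1›,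
      sq_nonneg (Real.sin (H / 2) - Real.sin ((H + -t) / 2))]
  have hp := neg_le_mul_of_bounds (by positivity) h1 h2 b1 b2
  have hprod : Real.sin (k / 2) * Real.sin (H / 2) * Real.sin ((k + t) / 2) * Real.sin ((H + -t) / 2) =
      (Real.sin (k / 2) * Real.sin ((k + t) / 2)) * (Real.sin (H / 2) * Real.sin ((H + -t) / 2)) := by ring
  rw [hprod]
  have := mul_nonneg hb (by linarith [hp] :
    0 ≤ (Real.sin (k / 2) * Real.sin ((k + t) / 2)) * (Real.sin (H / 2) * Real.sin ((H + -t) / 2)) + t ^ 2 / 16)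
  nlinarith

/-- The group velocity is differentiable with the quotient-rule derivative (`ω₂ > 0`). [folklore] -/
theorem hasDerivAt_groupVelocity {ω₂ : ℝ} (hω : 0 < ω₂) (k : ℝ) :
    HasDerivAt (groupVelocity ω₂)
      ((Real.cos k * dispersion ω₂ k - Real.sin k * groupVelocity ω₂ k) / dispersion ω₂ k ^ 2) k := by
  have h := (Real.hasDerivAt_sin k).div (hasDerivAt_dispersion hω k) (dispersion_pos hω k).ne'
  exact h

/-- The Lipschitz constant of the group velocity used below: `L(ω₂) = 1/√ω₂ + 1/√ω₂³`. -/
def velLip (ω₂ : ℝ) : ℝ := 1 / Real.sqrt ω₂ + 1 / Real.sqrt ω₂ ^ 3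

/-- `0 < L(ω₂)` for `ω₂ > 0`. [folklore] -/
theorem velLip_pos {ω₂ : ℝ} (hω : 0 < ω₂) : 0 < velLip ω₂ := by
  unfold velLip
  have := Real.sqrt_pos.mpr hω
  positivity

/-- `|ω''| ≤ L(ω₂)`: the quotient-rule derivative of `sin/ω` is bounded by `1/ω + 1/ω³ ≤ 1/√ω₂ + 1/√ω₂³`. -/
theorem abs_deriv_groupVelocity_le {ω₂ : ℝ} (hω : 0 < ω₂) (k : ℝ) :
    |(Real.cos k * dispersion ω₂ k - Real.sin k * groupVelocity ω₂ k) / dispersion ω₂ k ^ 2| ≤ velLip ω₂ := by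
  have hωk : 0 < dispersion ω₂ k := dispersion_pos hω k
  have hs : 0 < Real.sqrt ω₂ := Real.sqrt_pos.mpr hω
  have hsk : Real.sqrt ω₂ ≤ dispersion ω₂ k := sqrt_le_dispersion k
  set w := dispersion ω₂ k with hw
  have hgv : groupVelocity ω₂ k = Real.sin k / w := rfl
  rw [hgv, abs_div, abs_of_pos (by positivity : 0 < w ^ 2)]
  -- numerator bound: |cos k · w - sin k · (sin k / w)| ≤ w + 1/w
  have hnum : |Real.cos k * w - Real.sin k * (Real.sin k / w)| ≤ w + 1 / w := by
    have hc := Real.abs_cos_le_one k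
    have hsn := Real.abs_sin_le_one k
    have e : Real.sin k * (Real.sin k / w) = Real.sin k ^ 2 / w := by ring
    rw [e]
    calc |Real.cos k * w - Real.sin k ^ 2 / w| ≤ |Real.cos k * w| + |Real.sin k ^ 2 / w| := abs_sub _ _
      _ ≤ w + 1 / w := by
        apply add_le_add
        · rw [abs_mul, abs_of_pos hωk]
          nlinarith
        · rw [abs_div, abs_of_pos hωk, abs_of_nonneg (sq_nonneg _)]
          apply div_le_div_of_nonneg_right _ hωk.le
          nlinarith [Real.sin_sq_le_one k]
  calc |Real.cos k * w - Real.sin k * (Real.sin k / w)| / w ^ 2 ≤ (w + 1 / w) / w ^ 2 :=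
        div_le_div_of_nonneg_right hnum (by positivity)
    _ = 1 / w + 1 / w ^ 3 := by field_simp
    _ ≤ velLip ω₂ := by
        unfold velLip
        apply add_le_add
        · exact one_div_le_one_div_of_le hs hsk
        · apply one_div_le_one_div_of_le (by positivity)
          exact pow_le_pow_left₀ hs.le hsk 3

/-- **The group velocity is `L(ω₂)`-Lipschitz** (mean value theorem). [folklore] -/
theorem abs_groupVelocity_sub_le {ω₂ : ℝ} (hω : 0 < ω₂) (x y : ℝ) :
    |groupVelocity ω₂ x - groupVelocity ω₂ y| ≤ velLip ω₂ * |x - y| := by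
  have h := Convex.norm_image_sub_le_of_norm_hasDerivWithin_le
    (f := groupVelocity ω₂) (s := Set.univ)
    (fun z _ => (hasDerivAt_groupVelocity hω z).hasDerivWithinAt)
    (fun z _ => by rw [Real.norm_eq_abs]; exact abs_deriv_groupVelocity_le hω z)
    convex_univ (Set.mem_univ y) (Set.mem_univ x)
  simpa [Real.norm_eq_abs] using h

/-- **Jacobian bound on the grazing strip (input (ii) of STUB 1, for EVERY partner `k₂`)**:
`|∂₂Ω(k₁,k₂,k₃)| = |ω'(k₂) - ω'(k₁+k₂-k₃)| ≤ L(ω₂)·|k₃ - k₁|` — no geometry of the branch is needed. -/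
theorem resonanceJacobian_le {ω₂ : ℝ} (hω : 0 < ω₂) (k₁ k₂ k₃ : ℝ) :
    resonanceJacobian ω₂ k₁ k₂ k₃ ≤ velLip ω₂ * |k₃ - k₁| := by
  unfold resonanceJacobian
  have h := abs_groupVelocity_sub_le hω k₂ (k₁ + k₂ - k₃)
  have e : k₂ - (k₁ + k₂ - k₃) = k₃ - k₁ := by ring
  rwa [e] at h

/-- `(ω₁ω₂ω₃ω₄)² ≤ (ω₂+4)⁴`. [folklore] -/
theorem prod_dispersion_sq_le {ω₂ : ℝ} (hω : 0 ≤ ω₂) (k₁ k₂ k₃ k₄ : ℝ) :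
    (dispersion ω₂ k₁ * dispersion ω₂ k₂ * dispersion ω₂ k₃ * dispersion ω₂ k₄) ^ 2 ≤ (ω₂ + 4) ^ 4 := by
  have hb : ∀ k, dispersion ω₂ k ^ 2 ≤ ω₂ + 4 := fun k => by
    rw [dispersion_sq hω]; have := Real.neg_one_le_cos k; linarith
  have hn : ∀ k, 0 ≤ dispersion ω₂ k ^ 2 := fun k => sq_nonneg _
  have e : (dispersion ω₂ k₁ * dispersion ω₂ k₂ * dispersion ω₂ k₃ * dispersion ω₂ k₄) ^ 2 =
      dispersion ω₂ k₁ ^ 2 * dispersion ω₂ k₂ ^ 2 * dispersion ω₂ k₃ ^ 2 * dispersion ω₂ k₄ ^ 2 := by ring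
  rw [e]
  have e4 : (ω₂ + 4) ^ 4 = (ω₂ + 4) * (ω₂ + 4) * (ω₂ + 4) * (ω₂ + 4) := by ring
  rw [e4]
  have h12 := mul_le_mul (hb k₁) (hb k₂) (hn k₂) (by linarith [hn k₁, hb k₁])
  have h123 := mul_le_mul h12 (hb k₃) (hn k₃) (by positivity)
  exact mul_le_mul h123 (hb k₄) (hn k₄) (by positivity)

/-- **Collision-weight lower bound on the grazing strip (inputs (ii)+(iii) of STUB 1 combined)**: for
`ω₂ > 0`, `b ≥ 0`, `b t² ≤ a/2` and a partner `H` at which the Jacobian does not vanish,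
`w(k, H, k+t) ≥ (9/16π)·(a/2)²·(ω₂+4)⁻⁴ / (L(ω₂)|t|)`.  Valid for EVERY real `k, H, t` — the only
branch-specific input left for STUB 1 is that `H(k,t)` is resonant, non-trivial and a.e. unique. -/
theorem collisionWeight_ge_on_strip {ω₂ a b : ℝ} (hω : 0 < ω₂) (hb : 0 ≤ b) {k H t : ℝ}
    (hat : b * t ^ 2 ≤ a / 2) (hJ : resonanceJacobian ω₂ k H (k + t) ≠ 0) :
    alsPrefactor * (a / 2) ^ 2 / (ω₂ + 4) ^ 4 / (velLip ω₂ * |t|) ≤ collisionWeight ω₂ a b k H (k + t) := by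
  unfold collisionWeight
  have hpref := alsPrefactor_pos
  have hJpos : 0 < resonanceJacobian ω₂ k H (k + t) :=
    lt_of_le_of_ne (by unfold resonanceJacobian; positivity) (Ne.symm hJ)
  have hJle : resonanceJacobian ω₂ k H (k + t) ≤ velLip ω₂ * |t| := by
    have h := resonanceJacobian_le hω k H (k + t)
    have e : k + t - k = t := by ring
    rwa [e] at h
  have hLt : 0 < velLip ω₂ * |t| := lt_of_lt_of_le hJpos hJle
  have ha2 : 0 ≤ a / 2 := by nlinarith [sq_nonneg t]
  have hΦ : (a / 2) ^ 2 ≤ vertex a b k H (k + t) ^ 2 := by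
    have hv := vertex_ge_on_strip hb k H t (a := a)
    exact pow_le_pow_left₀ ha2 (by linarith) 2
  have hP : (dispersion ω₂ k * dispersion ω₂ H * dispersion ω₂ (k + t) * dispersion ω₂ (k + H - (k + t))) ^ 2 ≤
      (ω₂ + 4) ^ 4 := prod_dispersion_sq_le hω.le _ _ _ _
  have hPpos : 0 < (dispersion ω₂ k * dispersion ω₂ H * dispersion ω₂ (k + t) *
      dispersion ω₂ (k + H - (k + t))) ^ 2 := by
    have := dispersion_pos hω k; have := dispersion_pos hω H; have := dispersion_pos hω (k + t)
    have := dispersion_pos hω (k + H - (k + t))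
    positivity
  -- chain the four monotone steps
  calc alsPrefactor * (a / 2) ^ 2 / (ω₂ + 4) ^ 4 / (velLip ω₂ * |t|)
      ≤ alsPrefactor * vertex a b k H (k + t) ^ 2 / (ω₂ + 4) ^ 4 / (velLip ω₂ * |t|) := by
        gcongr
    _ ≤ alsPrefactor * vertex a b k H (k + t) ^ 2 /
          (dispersion ω₂ k * dispersion ω₂ H * dispersion ω₂ (k + t) * dispersion ω₂ (k + H - (k + t))) ^ 2 /
          (velLip ω₂ * |t|) := by
        gcongr
    _ ≤ _ := by
        gcongr


/-! ## 9. (cycle 2) Numerics — scripts `num/band.py`, `num/foldgal.py`, `num/linalg.py`,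
`num/tail_law.py` (pure python; attached as evidence `cycle2-numerics.txt` / `cycle2-scripts.txt`)

**(9a) Closed-form non-trivial partner (chord construction of card chord-quartic-abel).**
`P(k) = (ω(k), sin k)` lies on `C : (X² − ω₂ − 2)² + 4Y² = 4`; the line through `P(k₁)` and `−P(k₃)` meets
`C` in two further points, `P(k₂)` on the right oval (`X > 0`) and `−P(k₄)` on the left one; deflating the
known roots `λ = 0, 1` of the quartic in the line parameter leaves a QUADRATIC, so `h(k₁,k₃) = k₂` is an
explicit algebraic function (no root finding; energy conservation is automatic — no `X³` term).  Test
(`band.py`, `ω₂ ∈ {1, 4}`, 20000 random pairs each): 0 failures, 0 trivial roots, `max|Ω| = 1.6e-15`,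
`max|k₁+k₂−k₃−k₄ mod 2π| = 8e-15 / 1.0e-14`.  So the non-trivial resonant partner is UNIQUE for every
off-diagonal `(k₁, k₃)` (fourth independent confirmation), i.e. the uniqueness clause of `IsGrazingBranch`
is satisfiable for EVERY `t₀ > 0`, and STUBS 1/3/5 may take `H`/`h` in closed form.

**(9b) First-order structure of the moving partner map (new; for the STUB 2 provers).**
`H(k,t) = (k + t/2)* + t/2 + r(k,t)` with `r = O(t²)` UNIFORMLY: `r/t²` = `0.087 (k=0.3)`, `0.111 (k=1)`,
`0.103 (k=k_m)`, `0.068 (k=2)`, `−0.119 (k=−0.7)` for `t = 10⁻², 10⁻³, 10⁻⁴` alike (`ω₂ = 1`).  Hence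
(sup over all `k ∈ (−π,π]` of `|r|/t²` at `t = 10⁻³…10⁻²`: `0.119` at `ω₂ = 1`, `0.044` at `4`, `0.31`
at `0.3`), and in CLOSED FORM (second-order expansion of the resonance condition in `t`, checked to 5
digits at six `k`): `r(k,t) = κ(y)t² + O(t³)`, `κ(y) = (ω‴(y) − ω‴(y*))/(24 ω″(y*))`, `y = k + t/2`,
with the fold limit `κ → −ω⁗(k_m)/(12ω‴(k_m)) = β₂/2` (L'Hôpital; `0.1033` ✓).  Hence
`T_t := H(·,t) − t = τ_{−t/2} ∘ * ∘ τ_{t/2} + O(t²)`: to first order the partner map does not move with `t`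
at all — it is the velocity involution conjugated by the half shift — and the collision bracket is
`f(k)+f(H)−f(k+t)−f(H−t) = g̃_t(*y) − g̃_t(y) + O(t²)·f'`, `y = k + t/2`, `g̃_t := f(·+t/2) − f(·−t/2)` (the
SYMMETRIC difference).  At the fold, `g̃_t` of an `f` odd about `k_m` is even about `k_m`, hence
`*`-invariant to first order: this is the exact reason fold-odd packets are the softest family.  What
decorrelates is the SECOND-order displacement `≍ κt²` between the `*`-image of the bump of `g̃_t` at
`k_m − t/2` and its partner bump at `k_m + t/2` (curvature of `*` at distance `t/2` from its fixed point,
plus the drift `H(k_m,t) − k_m = β₂t²`: `(H(k_m,t)−k_m)/t² = 0.190, 0.198, 0.202, 0.205, 0.206` at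
`t = .4, .2, .1, .05, .025`, `→ β₂ = −v‴(k_m)/(6v″(k_m)) = 0.2066` ✓ planner 0.2061).  A bump of scale `ε`
therefore decorrelates for `|t| ≳ √(ε/κ)` — HALF of its inertial range in `log t` — but with bracket²
`→ 4‖f‖²` (four disjoint bumps) against `(f(k+t)−f(k))² → 2‖f‖²` in `G`: per octave of `ε` both `Q_H/N`
and `G/N` grow by `4 log 2 = 2.77`, so the MARGINAL constant of STUB 2 at the fold is `1`, not `½`.  The
skeleton's van-der-Corput heuristic "`∂_tT_t = β − 1 ≠ 0`" only ever acts through these `O(t²)` terms;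
replacing `T_t` by the pure conjugate `τ_{−t/2}*τ_{t/2}` (`foldgal.py … conj`) changes no exponent and
barely the constants (curvature alone suffices).

**(9c) Fold-local Rayleigh minimisation of STUB 2 (true softest directions, not guessed families).**
`V_J = span{He_m(u/ε_j) e^{−u²/2ε_j²} : m < 6, j ≤ J}`, `u = k − k_m`, `ε_j = ε₀2^{−j}` (`≤ 60` functions,
`ε` down to `2·10⁻⁴`), exact `H`; `t` log-uniform (24/decade, both signs), `k` on merged geometric grids
around the four centres where the bracket has fine structure; Gram matrix whitened (`rtol 1e−10`),
Jacobi eigensolver.  Validation against the planner's independent numpy pipeline (odd bump `m = 1`,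
`ω₂ = 1`, `t₀ = ½`): `Q_H/G = 0.067, 0.065, 0.118, 0.260` at `ε = .2, .1, .05, .025` (planner: min `0.065`,
then `0.118, 0.259`).  `λ(μ; J) := min_{V_J} (Q_H − μG)/N` (columns `J = 1…9`), `(ω₂, t₀) = (1, ½)`:
`μ = 0.4`: `−4.66, −4.69 ×8`;  `μ = 0.8`: `−10.46, −10.72 ×7, −10.74`;  `μ = 1.0`: `−13.47, −13.95 ×6,
−14.00, −14.21`;  `μ = 1.2`: `−16.52, −17.29, −17.30, −17.30, −17.77, −18.40, −19.60, −20.19, −21.23`;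
`μ = 1.5`: `−21.1, −22.5, −23.1, −24.5, −25.9, −27.2, −29.1, −30.4, −32.1`.  Converged in `J` (to `≤ 0.01`)
for every `μ ≤ 0.8`, creeping at `1.0`, diving linearly (`≈ (μ−1)·2.77`/octave) for `μ ≥ 1.2`: the
fold-local marginal log-coercivity constant is `c* = 1.0 ± 0.15`, with certified-on-`V_9` inequalities
`Q_H ≥ 0.8 G − 10.8 N` and `Q_H ≥ 1.0 G − 14.2 N`.  Same transition at `(1, ¼)` [`λ(1.0) = −19.6`], `(4, ½)`
[`−17.5`], `(0.3, ½)` [`−11.9`]; single odd bumps have per-octave increments `ΔQ_H/N = 2.8–2.9` vs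
`ΔG/N = 2.77` at all four points.  The minimisers for `μ < 1` live at the COARSEST scales (`G/N ≈ 8–16`):
the planner's minima `Q_H/G = 0.065 | 0.013 | 0.0029` (`t₀ = ½, ¼, ⅛`) are pre-asymptotic low-frequency
values, precisely what `C` absorbs (`C ≍ 4 log(1/t₀) + const`), and say nothing against the stub.
REGULAR PAIRS are not softer (`num/regulargal.py`, two-centre multiscale space at `k₀ = 2.4` AND its partner
`k₀* = 0.344`, `σ = (k*)'(k₀) = −0.50`, 80 functions, `ε → 4·10⁻⁴`, `(ω₂,t₀) = (1,½)`): `λ(μ;J)` converged for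
`μ ≤ 1.5` (`λ(1.0) = −5.08`, `λ(1.5) = −9.18`) and diving only from `μ = 2` (`−15.8 → −23.4` over `J = 1…7`);
single bumps `Q_H/G → 1.41` at `k₀`, `→ 2.78` at `k₀*` — correlating the two windows buys nothing asymptotically
(cf. the Fourier argument in §10.2).  So the fold is the binding region and the GLOBAL marginal constant of
STUB 2 is `c* ≈ 1`.

**(9d) The `δ^{5.5}` tail law, derived** (mechanism of §7 `no_uniform_gap`; `δ' := 1/ω₂ → 0`).  Near total
momentum `P = k₁ + k₂ = π + η`: `Ω/(√ω₂ δ') = η(sin k₁ − sin k₃) − δ'(cos²k₁ − cos²k₃) + O(δ'², η²)`, so the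
non-trivial sheet is `P = π − δ'(sin k₁ + sin k₃) + O(δ'²)` and the bracket of an odd `π`-periodic `ψ`
(the exact invariants of the `δ' = 0` resonance `P ≡ π`) is `δ'(sin k₁ + sin k₃)(ψ'(π−k₃) − ψ'(π−k₁)) +
O(δ'²)`, which vanishes at order `δ'` only if `ψ' ≡ const`, i.e. `ψ = 0`: NO odd invariant bifurcates
from the degenerate resonance at any large `ω₂`.  Weight: `(∏ω)⁻² ≍ ω₂⁻⁴`, `|∂₂Ω|⁻¹ ≍ ω₂^{1/2}` ⇒
`w ≍ ω₂^{−7/2}`; hence `q(sin k)/π ≍ ω₂^{−7/2}` and `q(sin 2k)/π ≍ ω₂^{−11/2}`.  Measured local slopes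
(`tail_law.py`, 600² midpoint grid, `(a,b) = (1,0)`, `ω₂ = 5→10→20→40→80→160`): `sin k`: `−2.80, −3.09,
−3.27, −3.38, −3.44`; `sin 2k`: `−4.44, −4.87, −5.15, −5.31, −5.40`; `sin 3k` as `sin k`, `sin 4k` as
`sin 2k` — converging to `−7/2` and `−11/2`.  (`δ = 1/(ω₂+2)`, so this is the `δ^{5.5}` of the 37-point
scans of gen 1 / cycle 1.)

## 10. (cycle 2) Audit of the six registered stubs of the picked line (typed statements; none cheaply
false, none vacuous, no junk model found) — `-- Targets` in the cdisprove sense; `payload.targets = []`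

1. `stub_grazingLowerBound` — TRUE-looking as typed (no oddness / `L²` needed, correctly).  (i) the
   uniqueness clause of `IsGrazingBranch` holds for every `t₀` by (9a); (ii) `w(k,H,k+t) ≥ c/|t|` off a null
   set for ANY `H`: `|∂₂Ω| = |ω'(H) − ω'(H−t)| ≤ ‖ω''‖∞|t|` (mean value theorem, no geometry),
   `(∏ω)² ≤ (ω₂+4)⁴`, and `Φ ≥ a − bt²` for ALL real `k, H, t` because each factor pair
   `sin(k/2)sin((k+t)/2) = (cos(t/2) − cos(k+t/2))/2`, `sin(H/2)sin((H−t)/2)` is `≥ −t²/16` and `≤ 1`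
   (product-to-sum; all three inequalities kernel-checked in §8b) — so `t₀² ≤ a/(2b)` gives `Φ ≥ a/2`; the junk `w = 0` at `∂₂Ω = 0` sits on the fold curve
   `k + t = argmax ṽ_t` through `(k_m, 0)`, a null set; wrap-around by `collisionWeight_add_two_pi`.
2. `stub_grazingDecorrelation` — NOT refuted; `C` is load-bearing (§8); numerically TRUE with `c* ≈ 1`
   (9c).  `∀ t₀ > 0` (not only small) is harmless: `Q_H` is monotone in `t₀` and `IsGrazingBranch ω₂ t₀ H` is
   satisfiable at every `t₀` (9a).  Its docstring mechanism should be corrected per (9b).  Regular points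
   are not softer: `T_t` maps a bump at `k₀` onto `k₀* ≠ k₀`, and two-window correlation would need
   `F(v + at) − F(v + bt) ≡ F(v+t) − F(v)` with `a − b = 1/σ ≠ ±1` — impossible over a range of `t`
   (Fourier), matching cycle 1 §3(B).
3. `stub_formLowerSemicontinuous` — TRUE-looking (Fatou on the lower integral).  Any sign of `a, b` is fine
   (`Φ² ≥ 0`); the pull-backs `(k₁,k₃) ↦ h, ↦ k₄` are real-analytic and nowhere locally constant (`h ≡ c`
   on an open set would make `ω'` invariant under arbitrarily small shifts), so null sets pull back to
   null sets; measurability of the `finsum` integrand is needed only up to a.e. equality.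
4. `stub_oddInfAttained` — TRUE-looking for ALL `ω₂ a b` as typed: at junk parameters (`ω₂ ≤ −4`, or
   `a = b = 0`, where `q ≡ 0`) the hypothesis `LogCoerciveAt` is FALSE (`G = ∞` on periodic `L²` functions
   with `f̂ₙ = n^{−1/2}/log n`), so no junk instance refutes the implication; compactness from
   `G(f) ≥ Σ K(n)|f̂ₙ|²`, `K(n) = 8∫₀^{n/2} sin²s ds/s = 4 log n + O(1) → ∞`; oddness and `‖f₀‖² = 1`
   survive the limit (odd part of the a.e. limit; scaling).
5. `stub_nullVectorRegularity` — with 6 equivalent to "no odd `L²` null vector" = half (a) of the crux;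
   nothing cheaper than cycle 1 §3(C) (bootstrap maps unobstructed); `a ≤ 4b` changes only a null set.
6. `stub_noOddC1Invariant` — PROVED in gen-1 evidence (`NoOddC1Invariant.lean`), `ContDiff 1` glue only.

## 11. (cycle 2) Literature (cycle 1 was search-degraded throughout)
* Spohn, *Collisional invariants for the phonon Boltzmann equation*, J. Stat. Phys. 124 (2006),
  arXiv:math-ph/0605069 — READ: the Proposition (`ψ = aω + c` a.s.) is stated and proved for `d ≥ 2`
  (Assumptions 1–2; the proof pairs distinct coordinate indices `α ≠ β`) and does not cover `d = 1`.
* Mendl–Lu–Lukkarinen, PRE 94 (2016) 062104, arXiv:1608.08308, §3 (READ): "The one-dimensional case is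
  more intricate but we do not expect any new solutions to appear for the nearest neighbor dispersion
  relations (if `δ = ½`, the proof of absence of additional solutions is given in [LS08])" — the pinned
  (`0 < δ < ½`) classification is still an EXPECTATION in print; no gap statement either way.
* crossref: "linearized phonon Boltzmann collision operator spectral gap pinned anharmonic chain" →
  Jäckle 1970 (acoustic: NO gap — the contrast case, excluded by `ω(0) > 0`), Mouhot–Strain 2007,
  Bernhoff 2022–24, Dudyński 2013 (gas/mixture Boltzmann, irrelevant); "collisional invariants phonon
  Boltzmann" → Spohn 2006 only.  Galaxy bm25 (pdf corpus): ALS06 itself, nothing else on topic.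
  OpenAlex/S2: HTTP 429 (rate-limited); local FTS index unavailable — partial degradation, recorded.
* Verdict unchanged: OPEN IN PRINT, no negative result, no special `ω₂` singled out anywhere.
-/

/-! ## Targets (lead's stuck stubs): `payload.targets = []`, `stuck_stubs = []` at this re-arm (no lead
cycle yet); the registered stubs are audited in §10 and STUB 2's `C` is pinned in §8. -/

end Summit.AtomisticToContinuum.FouriersLaw.Cruxes.FGRGap.Disproof

end
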